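import Literature.Computability.FineGrained.CliqueETHGroupingReduction
import Literature.Computability.FineGrained.BringmannCurves
import HarnessLib

/-!
# SETH-hardness of the discrete Fréchet distance: the word-RAM program of Bringmann's reduction

The program behind the theorem `kSATInRAMTime_of_discreteFrechetDecision_inTimeO` of
`…FineGrained.DiscreteFrechetReductionRun` (K. Bringmann, FOCS 2014, §3.1, "Proof of Thm. 1.1,
discrete case": an `O(n^{2-ε})` decider for the discrete Fréchet distance decides CNF-SAT in time
`O(M² 2^{(1-ε/2)N})`) — the machine half of the proof of the named fact
`not_discreteFrechetDecision_inTimeO_of_sethWordRAM` of `…FineGrained.SETHHardness`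
(fine-grained.S15, discrete Fréchet) — written as structured word-RAM code (`SProg` of `…WordRAMStructured`,
verified in the logic `SProg.Achieves` of `…WordRAMAchieves`) around one emulated run of the
hypothetical Fréchet decider (`SProg.withSubrun` of `…WordRAMSubrun`), and the proof that its
*build* phase computes, in closed form, the memory presenting the `DiscreteFrechetDecision`
encoding of Bringmann's instance (`FrechetRed.frechetInstance` of `…BringmannCurves`: the curves
`P₁, P₂` with integer coordinates and threshold `τ² = 3000²`) to the emulator. The architecture is
that of `…CliqueETHReductionProgram` (whose relocation-free helpers `sizeLoop`, `clearRegs`,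
`post` are reused); the run, the word-size and time analysis, and the proofs of the theorem and of
the named fact are in `…DiscreteFrechetReductionRun`.

* **The program** (`FrechetRed.pre kF cM`, `FrechetRed.reduction`): relocate the input
  (`SProg.relocate`); compute `n, m, n₁ = ⌊n/2⌋, n₂ = n - n₁, N₁ = 2^{n₁}, N₂ = 2^{n₂}`, the curve
  length `L₁ = N₁ (m + 3)`, the emulated input length `Ly = 2 (L₁ + L₂) + 2`
  (`L₂ = N₂ (m + 1) + 4`) and the base `Bv` of the emulated cells (`setup1`); the emulated input
  width value `max Ly 9·10⁶` (`selectWidth`), its bit size by halving (`CliqueRed.sizeLoop`), the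
  emulated word size `ws = kF · size`, modulus `Pw = 2^ws`, region size and the environment
  registers (`setup3`); the header `Ly, L₁, τ²` of the emulated input (`header`); the coordinate
  words of the first curve, block by block — for every half-assignment `A < N₁` the points
  `s₁, r₁`, one clause gadget per clause (the literal loop `litBody₁` computes
  `sat(a₁, Cᵢ)` bit by bit from the relocated clause list, `emit₁` writes the two words of
  `c₁ (i % 2) sat`), `t₁` (`curve₁`); the second curve likewise (`curve₂`, with `B << n₁`
  precomputed so that bit `v` of it is bit `v - n₁` of `B`); clear the scratch registers
  (`CliqueRed.clearRegs`); after the emulated run, `CliqueRed.post` copies the decider's answer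
  bit to the output. Every emulated cell is written reduced modulo `Pw`.
* **Ghost parameters** (`FrechetRed.Params`: `φ, kF, cM`, with `x, Lx, X, n, m, n₁, n₂, N₁, N₂,
  L₁, L₂, Ly, Bv, wv, ws, Pw, V, Sv, env, inst, y`), the word-size requirement `Params.Fits W`,
  and the intended data memory as a function of the list of emulated words written so far
  (`dataW`; the header `hdr`, the curve words `wordsP₁`, `wordsP₂`, `cgWords₁`, `cgWords₂`, and
  `final_eq`: the complete list is `Ly :: y`), `finData`, `finMem`.
* **Verification**, phase by phase, by symbolic execution of straight-line blocks and the counted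
  while rule: `setup1_spec`, `selectWidth_spec`, `setup3_spec`, `header_spec`, `lit₁_spec`,
  `clause₁_spec`, `blockA_spec`, `curve₁_spec`, their `₂` twins, and finally **`Params.pre_spec`**:
  on the initial memory of `x = encodeCNFWords φ` (word size `W` with `Fits W`) the build ends
  within `Params.Tpre` steps in exactly the memory `Params.finMem`.

## References

* K. Bringmann, *Why walking the dog takes time: Fréchet distance has no strongly subquadratic
  algorithms unless SETH fails*, FOCS 2014 (arXiv:1404.1448), §3.1.
* V. Vassilevska Williams, *On some fine-grained questions in algorithms and complexity*,
  Proc. ICM 2018, §2 (the word RAM; algorithms calling an algorithm for another problem).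
* T. Nipkow, G. Klein, *Concrete Semantics with Isabelle/HOL*, Springer 2014, §12 (verification
  of `WHILE` programs by invariants).
-/

namespace Literature.Computability.FineGrained

open Cryptography Cryptography.WordRAM Complexity Cryptography.WordRAM.SProg

namespace FrechetRed

/-! ### Operand shorthands -/

/-- Direct operand: register / cell `i`. [folklore] -/
abbrev r (i : ℕ) : Operand := .dir i
/-- Indirect operand through cell `i`. [folklore] -/
abbrev pt (i : ℕ) : Operand := .ind i
/-- Immediate operand. [folklore] -/
abbrev im (c : ℕ) : Operand := .imm c

/-! ### Register map

`0 = X` (base of the relocated input, `x[j]` in cell `X + j`), `1 = X - 1` (set by `relocate`);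
`2 = n` (variables), `3 = m` (clauses), `4 = n₁ = n / 2`, `5 = n₂ = n - n₁`, `6 = N₁ = 2^{n₁}`,
`7 = N₂ = 2^{n₂}`, `8 = L₁ = |P₁|`, `9 = Ly = |y|`; the emulator's layout `10 = Bv`, `11 = Sv`,
`12 = Gv (= 0)`, `13 = Pw = 2^ws`, temporaries `14, 15, 16`; `17` post; scratch `20–24` (setup),
`30` (write pointer), `31–50` (the curve loops). -/

/-- The emulator layout used by the reduction (the same as `CliqueRed.lay`). [folklore] -/
def lay : Layout := ⟨10, 11, 12, 13, 14, 15, 16⟩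

/-! ### Setup -/

/-- Setup, part 1: `n, m, n₁, n₂, N₁, N₂, L₁, Ly, Bv`, and `r22 := [Ly < 9·10⁶]`. [folklore] -/
def setup1 : SProg := block [
  (.band, r 2, pt 0, pt 0),
  (.add, r 20, r 0, im 1), (.band, r 3, pt 20, pt 20),
  (.div, r 4, r 2, im 2), (.sub, r 5, r 2, r 4),
  (.shl, r 6, im 1, r 4), (.shl, r 7, im 1, r 5),
  (.add, r 20, r 3, im 3), (.mul, r 8, r 6, r 20),
  (.add, r 20, r 3, im 1), (.mul, r 21, r 7, r 20), (.add, r 21, r 21, im 4),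
  (.add, r 9, r 8, r 21), (.mul, r 9, r 9, im 2), (.add, r 9, r 9, im 2),
  (.sub, r 20, r 1, im 100), (.add, r 10, r 1, r 20), (.add, r 10, r 10, im 1),
  (.lt, r 22, r 9, im 9000000)]

/-- Setup, part 2: `r21 := max Ly 9·10⁶` (the value whose bit size is the emulated input width),
`r22 := 0`. [folklore] -/
def selectWidth : SProg := seqs [
  ifz (r 22) (block [(.band, r 21, r 9, r 9)]) (block [(.band, r 21, im 9000000, im 9000000)]),
  block [(.band, r 22, im 0, im 0)]]

/-- Setup, part 3: `ws := kF · size`, `Pw := 2^ws`, `r23 := max (Pw - 1) (max cM Ly)`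
(`cM` the largest constant of the Fréchet program), `Sv := Bv + r23 + 1`, `Gv := 0`. [folklore] -/
def setup3 (kF cM : ℕ) : SProg := seqs [
  block [(.mul, r 22, r 22, im kF), (.shl, r 13, im 1, r 22), (.sub, r 23, r 13, im 1),
    (.lt, r 24, r 23, im cM)],
  ifz (r 24) skip (block [(.band, r 23, im cM, im cM)]),
  block [(.lt, r 24, r 23, r 9)],
  ifz (r 24) skip (block [(.band, r 23, r 9, r 9)]),
  block [(.add, r 11, r 10, r 23), (.add, r 11, r 11, im 1), (.band, r 12, im 0, im 0)]]

/-- The header of the emulated input: `|y|, |P₁|, τ²` (reduced modulo `Pw`), and the write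
pointer `r30 := Bv + 3`. [folklore] -/
def header : SProg := block [
  (.mod, pt 10, r 9, r 13),
  (.add, r 30, r 10, im 1), (.mod, pt 30, r 8, r 13),
  (.add, r 30, r 30, im 1), (.mod, pt 30, im 9000000, r 13),
  (.add, r 30, r 30, im 1)]

/-! ### Writing points -/

/-- Write the point with coordinate words `a, b` (constants) at the write pointer, reduced modulo
`Pw`, and advance. [folklore] -/
def writeConst (a b : ℕ) : SProg := block [
  (.mod, pt 30, im a, r 13), (.add, r 30, r 30, im 1),
  (.mod, pt 30, im b, r 13), (.add, r 30, r 30, im 1)]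

/-! ### The clause gadgets of the first curve -/

/-- One literal of the current clause, first curve: `r36 |= [var < n₁] ∧ [bit var of A = pol]`
(disjunction of bits as `[[a = 0] ∧ [b = 0] < 1]`, with the overflow-free `eq`/`band`/`lt`).
[folklore] -/
def litBody₁ : SProg := block [
  (.band, r 39, pt 38, pt 38), (.shr, r 40, r 39, im 1), (.band, r 41, r 39, im 1),
  (.lt, r 42, r 40, r 4),
  (.shr, r 43, r 31, r 40), (.band, r 43, r 43, im 1),
  (.eq, r 44, r 43, r 41), (.band, r 44, r 44, r 42),
  (.eq, r 45, r 36, im 0), (.eq, r 46, r 44, im 0), (.band, r 45, r 45, r 46), (.lt, r 36, r 45, im 1),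
  (.add, r 38, r 38, im 1), (.sub, r 37, r 37, im 1)]

/-- One literal of the current clause, second curve: `r36 |= [n₁ ≤ var] ∧ [bit var of (B << n₁) = pol]`.
[folklore] -/
def litBody₂ : SProg := block [
  (.band, r 39, pt 38, pt 38), (.shr, r 40, r 39, im 1), (.band, r 41, r 39, im 1),
  (.lt, r 42, r 40, r 4), (.eq, r 42, r 42, im 0),
  (.shr, r 43, r 50, r 40), (.band, r 43, r 43, im 1),
  (.eq, r 44, r 43, r 41), (.band, r 44, r 44, r 42),
  (.eq, r 45, r 36, im 0), (.eq, r 46, r 44, im 0), (.band, r 45, r 45, r 46), (.lt, r 36, r 45, im 1),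
  (.add, r 38, r 38, im 1), (.sub, r 37, r 37, im 1)]

/-- Start of a clause: `sat := 0`, `len := [q]`, literal pointer `q + 1`. [folklore] -/
def clauseInit : SProg := block [
  (.band, r 36, im 0, im 0), (.band, r 37, pt 35, pt 35), (.add, r 38, r 35, im 1)]

/-- Emit the clause gadget of the first curve: `x = 2000 · parity + 2000`, `y = 7806 - 12 · sat`
(the words of `c₁`), toggle the parity, advance the clause pointer and the counters. [folklore] -/
def emit₁ : SProg := block [
  (.mul, r 48, r 47, im 2000), (.add, r 48, r 48, im 2000), (.mod, pt 30, r 48, r 13),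
  (.add, r 30, r 30, im 1),
  (.mul, r 48, r 36, im 12), (.sub, r 48, im 7806, r 48), (.mod, pt 30, r 48, r 13),
  (.add, r 30, r 30, im 1),
  (.eq, r 47, r 47, im 0), (.band, r 35, r 38, r 38), (.add, r 33, r 33, im 1),
  (.sub, r 34, r 34, im 1)]

/-- Emit the clause gadget of the second curve: `x = 2000 · parity + 2000`, `y = 1794 + 12 · sat`
(the words of `c₂`). [folklore] -/
def emit₂ : SProg := block [
  (.mul, r 48, r 47, im 2000), (.add, r 48, r 48, im 2000), (.mod, pt 30, r 48, r 13),
  (.add, r 30, r 30, im 1),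
  (.mul, r 48, r 36, im 12), (.add, r 48, r 48, im 1794), (.mod, pt 30, r 48, r 13),
  (.add, r 30, r 30, im 1),
  (.eq, r 47, r 47, im 0), (.band, r 35, r 38, r 38), (.add, r 33, r 33, im 1),
  (.sub, r 34, r 34, im 1)]

/-- One clause gadget of the first curve. [folklore] -/
def clauseBody₁ : SProg := seqs [clauseInit, whilenz (r 37) litBody₁, emit₁]

/-- One clause gadget of the second curve. [folklore] -/
def clauseBody₂ : SProg := seqs [clauseInit, whilenz (r 37) litBody₂, emit₂]

/-- Start of an assignment gadget: clause index `0`, countdown `m`, clause pointer `X + 2`,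
parity `0`. [folklore] -/
def gadgetInit : SProg := block [
  (.band, r 33, im 0, im 0), (.band, r 34, r 3, r 3), (.add, r 35, r 0, im 2),
  (.band, r 47, im 0, im 0)]

/-- Advance the assignment counter. [folklore] -/
def nextAssignment : SProg := block [(.add, r 31, r 31, im 1), (.sub, r 32, r 32, im 1)]

/-- One block `s₁ ∘ AG(a₁) ∘ t₁` of the first curve. [folklore] -/
def blockA : SProg := seqs [
  writeConst 0 6000, writeConst 0 7800, gadgetInit, whilenz (r 34) clauseBody₁,
  writeConst 4000 6000, nextAssignment]

/-- The first curve: all blocks, `A = 0, …, N₁ - 1`. [folklore] -/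
def curve₁ : SProg := seqs [
  block [(.band, r 31, im 0, im 0), (.band, r 32, r 6, r 6)],
  whilenz (r 32) blockA]

/-- One assignment gadget `AG(a₂)` of the second curve (with `r50 := B << n₁`). [folklore] -/
def blockB : SProg := seqs [
  block [(.shl, r 50, r 31, r 4)], writeConst 0 1800, gadgetInit, whilenz (r 34) clauseBody₂,
  nextAssignment]

/-- The second curve: `s₂, s₂*`, all assignment gadgets, `t₂*, t₂`. [folklore] -/
def curve₂ : SProg := seqs [
  writeConst 0 4800, writeConst 0 0,
  block [(.band, r 31, im 0, im 0), (.band, r 32, r 7, r 7)],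
  whilenz (r 32) blockB,
  writeConst 4000 0, writeConst 4000 4800]

/-! ### The build, the read-out, the reduction program -/

/-- **The build**: relocate the input, compute the constants and the emulator's environment,
write the emulated input `y` (header and the two curves), clear the scratch registers.
(`kF`, `cM`: word-size constant and largest constant of the Fréchet program.) [folklore] -/
def pre (kF cM : ℕ) : SProg := seqs [
  relocate, setup1, selectWidth, CliqueRed.sizeLoop, setup3 kF cM, header, curve₁, curve₂,
  CliqueRed.clearRegs]

/-- **The reduction program**: `k`-SAT by one emulated run of the Fréchet decider `M`
(read-out `CliqueRed.post`: output the emulated cell `1`). [folklore] -/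
def reduction (M : Program) (kF : ℕ) : Program :=
  withSubrun (pre kF M.maxConst) lay M CliqueRed.post

/-- The build is query-free. [folklore] -/
theorem pre_queryFree (kF cM : ℕ) : (pre kF cM).QueryFree := by
  refine seqs_queryFree ?_
  simp only [List.mem_cons, List.not_mem_nil, or_false]
  rintro s (rfl | rfl | rfl | rfl | rfl | rfl | rfl | rfl | rfl)
  · exact relocate_queryFree
  · exact block_queryFree _
  · simp [selectWidth, seqs, QueryFree, block_queryFree]
  · exact ⟨trivial, block_queryFree _⟩
  · simp [setup3, seqs, QueryFree, block_queryFree]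
  · exact block_queryFree _
  · simp [curve₁, blockA, clauseBody₁, clauseInit, emit₁, litBody₁, gadgetInit, nextAssignment,
      writeConst, seqs, QueryFree, block_queryFree]
  · simp [curve₂, blockB, clauseBody₂, clauseInit, emit₂, litBody₂, gadgetInit, nextAssignment,
      writeConst, seqs, QueryFree, block_queryFree]
  · exact block_queryFree _

/-- The reduction program is deterministic. [folklore] -/
theorem reduction_isDeterministic (M : Program) (kF : ℕ) : (reduction M kF).IsDeterministic :=
  withSubrun_isDeterministic _ _ _ _

/-- The reduction program is oracle-free. [folklore] -/
theorem reduction_isOracleFree (M : Program) (kF : ℕ) : (reduction M kF).IsOracleFree :=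
  withSubrun_isOracleFree (pre_queryFree _ _) CliqueRed.post_queryFree _ _

/-! ### Ghost parameters of a run -/

/-- The data of a run of the reduction: the formula, and the word-size constant `kF` and largest
constant `cM` of the Fréchet program. [folklore] -/
structure Params where
  /-- The input formula. -/
  φ : CNF ℕ
  /-- The word-size constant of the Fréchet program. -/
  kF : ℕ
  /-- The largest constant of the Fréchet program. -/
  cM : ℕ

namespace Params

variable (g : Params)

/-- The input words. [folklore] -/
def x : List ℕ := encodeCNFWords g.φ
/-- The input length `Lx`. [folklore] -/
def Lx : ℕ := g.x.length
/-- The base `X` of the relocated input: `x[j]` sits in cell `X + j`. [folklore] -/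
def X : ℕ := g.Lx + 101
/-- The number of variables `n`. [folklore] -/
def n : ℕ := g.φ.numVars
/-- The number of clauses `m`. [folklore] -/
def m : ℕ := g.φ.length
/-- The size of the first half of the variables, `n₁ = ⌊n / 2⌋`. [folklore] -/
def n₁ : ℕ := g.n / 2
/-- The size of the second half, `n₂ = n - n₁`. [folklore] -/
def n₂ : ℕ := g.n - g.n₁
/-- The number of half-assignments of the first half, `N₁ = 2^{n₁}`. [folklore] -/
def N₁ : ℕ := 2 ^ g.n₁
/-- The number of half-assignments of the second half, `N₂ = 2^{n₂}`. [folklore] -/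
def N₂ : ℕ := 2 ^ g.n₂
/-- The length of the first curve, `L₁ = N₁ (m + 3)`. [folklore] -/
def L₁ : ℕ := g.N₁ * (g.m + 3)
/-- The length of the second curve, `L₂ = N₂ (m + 1) + 4`. [folklore] -/
def L₂ : ℕ := g.N₂ * (g.m + 1) + 4
/-- The length of the emulated input, `Ly = 2 (L₁ + L₂) + 2`. [folklore] -/
def Ly : ℕ := (g.L₁ + g.L₂) * 2 + 2
/-- Base of the emulated cells (right after the relocated input). [folklore] -/
def Bv : ℕ := g.X + g.Lx
/-- The value whose bit size is the input width of the emulated input: `max Ly 9·10⁶`. [folklore] -/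
def wv : ℕ := max g.Ly 9000000
/-- The emulated word size `ws = kF · size wv`. [folklore] -/
def ws : ℕ := Nat.size g.wv * g.kF
/-- The emulated modulus `Pw = 2^ws`. [folklore] -/
def Pw : ℕ := 2 ^ g.ws
/-- The value bound `V = max (Pw - 1) (max cM Ly)` of the emulation. [folklore] -/
def V : ℕ := max (g.Pw - 1) (max g.cM g.Ly)
/-- Base of the stamps. [folklore] -/
def Sv : ℕ := g.Bv + g.V + 1
/-- The emulator environment: cells at `Bv`, stamps at `Sv`, generation `0`, word size `ws`,
region size `V + 1`. [folklore] -/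
def env : Env := ⟨g.Bv, g.Sv, 0, g.ws, g.V + 1⟩
/-- Bringmann's instance of the formula (halves `n₁`, `n₂`). [cite: BringmannFOCS2014, §3.1] -/
noncomputable def inst : DiscreteFrechetDecision.Inst := frechetInstance g.φ g.n₁ g.n₂
/-- The emulated input: the `DiscreteFrechetDecision` encoding of Bringmann's instance. [folklore] -/
noncomputable def y : List ℕ := DiscreteFrechetDecision.encode g.inst

/-- The chain of bases. [folklore] -/
theorem bases : 100 < g.X ∧ g.X = g.Lx + 101 ∧ g.X + g.Lx = g.Bv ∧ g.Bv + g.V + 1 = g.Sv :=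
  ⟨by unfold X; omega, rfl, rfl, rfl⟩

/-- `2 ≤ Lx`: the encoding starts with `numVars, numClauses`. [folklore] -/
theorem two_le_Lx : 2 ≤ g.Lx := by
  unfold Lx x; rw [length_encodeCNFWords_eq]; omega

/-- `m + 2 ≤ Lx`. [folklore] -/
theorem m_add_two_le_Lx : g.m + 2 ≤ g.Lx := by
  unfold Lx x m; rw [length_encodeCNFWords_eq, CNF.numClauses]; omega

/-- The halves cover the variables: `n = n₁ + n₂`, `n₁ ≤ n₂`. [folklore] -/
theorem n_eq : g.n = g.n₁ + g.n₂ ∧ g.n₁ ≤ g.n₂ := by unfold n₂ n₁; omega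

/-- `Ly ≤ V`, `cM ≤ V`, `Pw - 1 ≤ V`. [folklore] -/
theorem le_V : g.Ly ≤ g.V ∧ g.cM ≤ g.V ∧ g.Pw - 1 ≤ g.V :=
  ⟨le_max_of_le_right (le_max_right _ _), le_max_of_le_right (le_max_left _ _), le_max_left _ _⟩

/-- The defining equations of the lengths, for linear arithmetic. [folklore] -/
theorem lengths : g.L₁ = g.N₁ * (g.m + 3) ∧ g.L₂ = g.N₂ * (g.m + 1) + 4 ∧
    g.Ly = (g.L₁ + g.L₂) * 2 + 2 ∧ 1 ≤ g.N₁ ∧ 1 ≤ g.N₂ ∧ 1 ≤ g.Pw :=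
  ⟨rfl, rfl, rfl, Nat.one_le_two_pow, Nat.one_le_two_pow, Nat.one_le_two_pow⟩

/-- **Word-size requirements** of a run at word size `W`: the stamps fit (`Sv + V + 1 ≤ 2 ^ W`,
whence every address and every length fits), the emulated word size and the number of variables
are below `W`, the input width is at most `W` (so the input is stored exactly), and `W ≥ 24` (so
the coordinate constants and `τ²` fit). [folklore] -/
structure Fits (W : ℕ) : Prop where
  top : g.Sv + g.V + 1 ≤ 2 ^ W
  ws_lt : g.ws < W
  n_le : g.n ≤ W
  width : inputWidth g.x ≤ W
  w24 : 24 ≤ W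

/-- Under `Fits`, the input words fit. [folklore] -/
theorem Fits.input {g : Params} {W : ℕ} (h : g.Fits W) : ∀ v ∈ g.x, v < 2 ^ W := fun v hv =>
  lt_of_lt_of_le (lt_two_pow_inputWidth_of_mem g.x v hv) (Nat.pow_le_pow_right Nat.two_pos h.width)

/-- The standard linear facts about the ghost parameters under `Fits`. [folklore] -/
theorem facts {W : ℕ} (hF : g.Fits W) :
    100 < g.X ∧ g.X = g.Lx + 101 ∧ g.X + g.Lx = g.Bv ∧ g.Bv + g.V + 1 = g.Sv ∧
    g.Sv + g.V + 1 ≤ 2 ^ W ∧ g.Ly ≤ g.V ∧ g.Pw ≤ g.V + 1 ∧ g.cM ≤ g.V ∧ g.m + 2 ≤ g.Lx ∧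
    g.L₁ = g.N₁ * (g.m + 3) ∧ g.L₂ = g.N₂ * (g.m + 1) + 4 ∧ g.Ly = (g.L₁ + g.L₂) * 2 + 2 ∧
    1 ≤ g.N₁ ∧ 1 ≤ g.N₂ ∧ 1 ≤ g.Pw ∧ g.n = g.n₁ + g.n₂ ∧ g.n₁ ≤ g.n₂ ∧ g.n ≤ W ∧
    16777216 ≤ 2 ^ W ∧ g.N₁ * g.N₂ ≤ 2 ^ W ∧ g.Pw < 2 ^ W ∧ g.N₁ ≤ g.L₁ ∧ g.N₂ ≤ g.L₂ ∧
    W < 2 ^ W := by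
  obtain ⟨h1, h2, h3, h4⟩ := g.bases
  obtain ⟨h5, h6, h7⟩ := g.le_V
  obtain ⟨h8, h9, h10, h11, h12, h13⟩ := g.lengths
  obtain ⟨h14, h15⟩ := g.n_eq
  have h16 : 16777216 ≤ 2 ^ W := by
    calc (16777216 : ℕ) = 2 ^ 24 := by norm_num
      _ ≤ 2 ^ W := Nat.pow_le_pow_right Nat.two_pos hF.w24
  have h17 : g.N₁ * g.N₂ ≤ 2 ^ W := by
    unfold N₁ N₂; rw [← Nat.pow_add, ← h14]; exact Nat.pow_le_pow_right Nat.two_pos hF.n_le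
  have h18 : g.Pw < 2 ^ W := Nat.pow_lt_pow_right (by norm_num) hF.ws_lt
  have h19 : g.N₁ ≤ g.L₁ := Nat.le_mul_of_pos_right _ (by omega)
  have h20 : g.N₂ ≤ g.L₂ := by
    unfold L₂; exact le_add_right (Nat.le_mul_of_pos_right _ (by omega))
  exact ⟨h1, h2, h3, h4, hF.top, h5, by omega, h6, g.m_add_two_le_Lx, h8, h9, h10, h11, h12, h13,
    h14, h15, hF.n_le, h16, h17, h18, h19, h20, Nat.lt_two_pow_self⟩

/-! ### Reading the relocated input -/

/-- Cell `0` after relocation holds `X`. [folklore] -/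
@[simp] theorem relocated_zero' : relocated g.x 0 = g.X := by
  rw [relocated_zero]; rfl

/-- Cell `1` after relocation holds `X - 1`. [folklore] -/
@[simp] theorem relocated_one' : relocated g.x 1 = g.X - 1 := by
  rw [relocated_one]; unfold X Lx; omega

/-- The relocated input: `x[j]` sits in cell `X + j` (and `0` past the input). [folklore] -/
theorem relocated_X_add (j : ℕ) : relocated g.x (g.X + j) = g.x.getD j 0 := by
  by_cases hj : j < g.Lx
  · have := relocated_base_add g.x (i := j + 1) (by omega) (by unfold Lx at hj; omega)
    rw [show g.x.length + 100 + (j + 1) = g.X + j by unfold X Lx; omega] at this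
    rw [this]; rfl
  · rw [relocated_of_lt g.x (by unfold X Lx at *; omega),
      List.getD_eq_default _ _ (by unfold Lx at hj; omega)]

/-- Everything from the emulated base on is `0` after relocation. [folklore] -/
theorem relocated_of_Bv_le {a : ℕ} (ha : g.Bv ≤ a) : relocated g.x a = 0 :=
  relocated_of_lt g.x (by unfold Bv X Lx at ha; omega)

/-- Word `0` of the input is `n`. [folklore] -/
theorem relocated_X : relocated g.x g.X = g.n := by
  have := g.relocated_X_add 0
  rw [Nat.add_zero] at this
  rw [this]; unfold x n; rw [List.getD_eq_getElem?_getD, encodeCNFWords_getElem?_zero]; rfl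

/-- Word `1` of the input is `m`. [folklore] -/
theorem relocated_X_one : relocated g.x (g.X + 1) = g.m := by
  rw [relocated_X_add]; unfold x m; rw [List.getD_eq_getElem?_getD, encodeCNFWords_getElem?_one]
  rfl

/-- The length word of clause `q` in the input. [folklore] -/
theorem x_getD_clauseStart {q : ℕ} (hq : q < g.m) :
    g.x.getD (clauseStart g.φ q) 0 = (g.φ[q]'hq).length := by
  have := encodeCNFWords_getElem?_clauseStart g.φ hq
  unfold x; rw [List.getD_eq_getElem?_getD, this]; rfl

/-- The literal words of clause `q` in the input. [folklore] -/
theorem x_getD_lit {q : ℕ} (hq : q < g.m) {l : ℕ} (hl : l < (g.φ[q]'hq).length) :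
    g.x.getD (clauseStart g.φ q + 1 + l) 0 = litCode ((g.φ[q]'hq)[l]'hl) := by
  have := encodeCNFWords_getElem?_clauseStart_succ g.φ hq hl
  unfold x; rw [List.getD_eq_getElem?_getD, this]; rfl

/-- Clause blocks lie inside the input. [folklore] -/
theorem clauseStart_le {q : ℕ} (hq : q < g.m) :
    clauseStart g.φ q + 1 + (g.φ[q]'hq).length ≤ g.Lx := by
  have := clauseStart_add_length_le g.φ hq; unfold Lx x; exact this

/-- `clauseStart` at `m` is at most `Lx`. [folklore] -/
theorem clauseStart_m_le : clauseStart g.φ g.m ≤ g.Lx := by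
  unfold Lx x m; rw [length_encodeCNFWords]

/-- Input words are below `2 ^ W`. [folklore] -/
theorem x_getD_lt {W : ℕ} (hF : g.Fits W) (j : ℕ) : g.x.getD j 0 < 2 ^ W := by
  rw [List.getD_eq_getElem?_getD]
  cases h : g.x[j]? with
  | none => simp
  | some v => simpa using hF.input v (List.mem_of_getElem? h)

/-! ### The emulated input as a list of words -/

/-- The two words of a point: the zig-zag codes of its coordinates. [folklore] -/
def ptWords (p : ℤ × ℤ) : List ℕ := [encodeInt p.1, encodeInt p.2]

/-- The header of the emulated memory: `|y|, |P₁|, τ²`. [folklore] -/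
def hdr : List ℕ := [g.Ly, g.L₁, 9000000]

/-- The words of the first `A` blocks of the first curve. [folklore] -/
def wordsP₁ (A : ℕ) : List ℕ :=
  (((List.range A).map (block₁ g.φ g.n₁)).flatten).flatMap ptWords

/-- The words of the first `i` clause gadgets of block `A` of the first curve. [folklore] -/
def cgWords₁ (A i : ℕ) : List ℕ :=
  ((List.range i).map fun j => c₁ (j % 2) (sat₁ g.n₁ A (g.φ.getD j []))).flatMap ptWords

/-- The words of the first `B` assignment gadgets of the second curve. [folklore] -/
def wordsP₂ (B : ℕ) : List ℕ :=
  (((List.range B).map (gadget₂ g.φ g.n₁)).flatten).flatMap ptWords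

/-- The words of the first `i` clause gadgets of gadget `B` of the second curve. [folklore] -/
def cgWords₂ (B i : ℕ) : List ℕ :=
  ((List.range i).map fun j => c₂ (j % 2) (sat₂ g.n₁ B (g.φ.getD j []))).flatMap ptWords

/-- The words written before the gadgets of the second curve. [folklore] -/
def pre₂ : List ℕ := g.hdr ++ g.wordsP₁ g.N₁ ++ ptWords s₂ ++ ptWords s₂'

/-- A list of points has two words per point. [folklore] -/
theorem length_flatMap_ptWords (L : List (ℤ × ℤ)) : (L.flatMap ptWords).length = L.length * 2 := by
  induction L with
  | nil => rfl
  | cons p L ih =>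
    rw [List.flatMap_cons, List.length_append, ih, List.length_cons]
    simp [ptWords]; ring

/-- The length of a block of the first curve. [folklore] -/
theorem length_block₁ (A : ℕ) : (block₁ g.φ g.n₁ A).length = g.m + 3 := by
  simp [block₁, gadget₁, m]

/-- The length of an assignment gadget of the second curve. [folklore] -/
theorem length_gadget₂ (B : ℕ) : (gadget₂ g.φ g.n₁ B).length = g.m + 1 := by
  simp [gadget₂, m]

/-- The emulated input, unfolded. [folklore] -/
theorem y_eq : g.y = (curveP₁ g.φ g.n₁).length :: 9000000 ::
    (curveP₁ g.φ g.n₁ ++ curveP₂ g.φ g.n₁ g.n₂).flatMap ptWords := rfl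

/-- `L₁ = |P₁|`. [folklore] -/
theorem L₁_eq : g.L₁ = (curveP₁ g.φ g.n₁).length := by
  rw [length_curveP₁]; rfl

/-- `L₂ = |P₂|`. [folklore] -/
theorem L₂_eq : g.L₂ = (curveP₂ g.φ g.n₁ g.n₂).length := by
  rw [length_curveP₂]; rfl

/-- `|y| = Ly`. [folklore] -/
theorem length_y : g.y.length = g.Ly := by
  rw [y_eq]
  simp only [List.length_cons, length_flatMap_ptWords, List.length_append]
  rw [← L₁_eq, ← L₂_eq]; unfold Ly; ring

/-- The words of one more block. [folklore] -/
theorem wordsP₁_succ (A : ℕ) :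
    g.wordsP₁ (A + 1) = g.wordsP₁ A ++ (block₁ g.φ g.n₁ A).flatMap ptWords := by
  simp [wordsP₁, List.range_succ, List.flatMap_append]

/-- The words of one more clause gadget (first curve). [folklore] -/
theorem cgWords₁_succ (A i : ℕ) :
    g.cgWords₁ A (i + 1) = g.cgWords₁ A i ++ ptWords (c₁ (i % 2) (sat₁ g.n₁ A (g.φ.getD i []))) := by
  simp [cgWords₁, List.range_succ, List.flatMap_append]

/-- The words of a whole block. [folklore] -/
theorem flatMap_block₁ (A : ℕ) : (block₁ g.φ g.n₁ A).flatMap ptWords =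
    ptWords s₁ ++ ptWords r₁ ++ g.cgWords₁ A g.m ++ ptWords t₁ := by
  simp [block₁, gadget₁, clauseGadgets₁, cgWords₁, m, List.flatMap_append]

/-- The words of one more assignment gadget. [folklore] -/
theorem wordsP₂_succ (B : ℕ) :
    g.wordsP₂ (B + 1) = g.wordsP₂ B ++ (gadget₂ g.φ g.n₁ B).flatMap ptWords := by
  simp [wordsP₂, List.range_succ, List.flatMap_append]

/-- The words of one more clause gadget (second curve). [folklore] -/
theorem cgWords₂_succ (B i : ℕ) :
    g.cgWords₂ B (i + 1) = g.cgWords₂ B i ++ ptWords (c₂ (i % 2) (sat₂ g.n₁ B (g.φ.getD i []))) := by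
  simp [cgWords₂, List.range_succ, List.flatMap_append]

/-- The words of a whole assignment gadget. [folklore] -/
theorem flatMap_gadget₂ (B : ℕ) : (gadget₂ g.φ g.n₁ B).flatMap ptWords =
    ptWords r₂ ++ g.cgWords₂ B g.m := by
  simp [gadget₂, clauseGadgets₂, cgWords₂, m]

/-- **The complete list of emulated words is `|y| :: y`.** [folklore] -/
theorem final_eq : g.pre₂ ++ g.wordsP₂ g.N₂ ++ ptWords t₂' ++ ptWords t₂ = g.Ly :: g.y := by
  rw [y_eq, pre₂, hdr, L₁_eq]
  simp [wordsP₁, wordsP₂, curveP₁, curveP₂, gadgets₂, N₁, N₂, List.flatMap_append]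

/-- Lengths of the word lists. [folklore] -/
theorem length_words : (∀ A, (g.wordsP₁ A).length = A * (g.m + 3) * 2) ∧
    (∀ A i, (g.cgWords₁ A i).length = i * 2) ∧ (∀ B, (g.wordsP₂ B).length = B * (g.m + 1) * 2) ∧
    (∀ B i, (g.cgWords₂ B i).length = i * 2) ∧ g.hdr.length = 3 ∧
    g.pre₂.length = 3 + g.L₁ * 2 + 4 := by
  have h1 : ∀ A, (g.wordsP₁ A).length = A * (g.m + 3) * 2 := fun A => by
    induction A with
    | zero => simp [wordsP₁]
    | succ A ih =>
      rw [wordsP₁_succ, List.length_append, ih, length_flatMap_ptWords, length_block₁]; ring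
  have h3 : ∀ B, (g.wordsP₂ B).length = B * (g.m + 1) * 2 := fun B => by
    induction B with
    | zero => simp [wordsP₂]
    | succ B ih =>
      rw [wordsP₂_succ, List.length_append, ih, length_flatMap_ptWords, length_gadget₂]; ring
  refine ⟨h1, fun A i => ?_, h3, fun B i => ?_, rfl, ?_⟩
  · rw [cgWords₁, length_flatMap_ptWords]; simp
  · rw [cgWords₂, length_flatMap_ptWords]; simp
  · simp only [pre₂, hdr, List.length_append, h1, List.length_cons, List.length_nil, ptWords]
    unfold L₁; ring

/-! ### The intended data memory -/

/-- The data memory after the emulated words `l` have been written from `Bv` on (each reduced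
modulo `Pw`): below `Bv` the relocated input, then `l`, then `0`. [folklore] -/
def dataW (l : List ℕ) (a : ℕ) : ℕ :=
  if a < g.Bv then relocated g.x a else if a - g.Bv < l.length then l.getD (a - g.Bv) 0 % g.Pw else 0

/-- The final data: relocated input and the emulated input `y` (with its length). [folklore] -/
noncomputable def finData : ℕ → ℕ := g.dataW (g.Ly :: g.y)

/-- **The final memory of the build**: registers `10–13` hold `Bv, Sv, 0, Pw`, every other
register is `0`, and the data is `finData`. [folklore] -/
noncomputable def finMem (a : ℕ) : ℕ :=
  if a < 100 then (if a = 10 then g.Bv else if a = 11 then g.Sv else if a = 13 then g.Pw else 0)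
  else g.finData a

/-- Before anything is written the data is the relocated input. [folklore] -/
theorem dataW_nil : g.dataW [] = relocated g.x := by
  funext a; unfold dataW
  split_ifs with h1 h2
  · rfl
  · simp at h2
  · exact (g.relocated_of_Bv_le (not_lt.1 h1)).symm

/-- **Writing one more word** at the write pointer `Bv + |l|`. [folklore] -/
theorem dataW_write (l : List ℕ) (v : ℕ) :
    Function.update (g.dataW l) (g.Bv + l.length) (v % g.Pw) = g.dataW (l ++ [v]) := by
  funext a
  by_cases ha : a = g.Bv + l.length
  · subst ha
    rw [Function.update_self]
    unfold dataW
    rw [if_neg (by omega), if_pos (by simp), Nat.add_sub_cancel_left,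
      List.getD_eq_getElem _ _ (by simp), List.getElem_append_right (by omega)]
    simp
  · rw [Function.update_of_ne ha]
    unfold dataW
    split_ifs with h1 h2 h3 h3
    · rfl
    · rw [List.getD_eq_getElem _ _ h2, List.getD_eq_getElem _ _ h3, List.getElem_append_left]
    · simp at h3; omega
    · simp at h2 h3; omega
    · rfl

/-- Data cells below `Bv` are the relocated input whatever has been written. [folklore] -/
theorem dataW_of_lt (l : List ℕ) {a : ℕ} (ha : a < g.Bv) : g.dataW l a = relocated g.x a := by
  unfold dataW; rw [if_pos ha]

/-- The cell just written. [folklore] -/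
theorem dataW_append_at (l : List ℕ) (v : ℕ) : g.dataW (l ++ [v]) (g.Bv + l.length) = v % g.Pw := by
  rw [← dataW_write, Function.update_self]

/-- Writing does not change the other cells. [folklore] -/
theorem dataW_append_of_ne (l : List ℕ) (v : ℕ) {a : ℕ} (ha : a ≠ g.Bv + l.length) :
    g.dataW (l ++ [v]) a = g.dataW l a := by
  rw [← dataW_write, Function.update_of_ne ha]

/-- Cells from the write pointer on are still `0`. [folklore] -/
theorem dataW_of_le (l : List ℕ) {a : ℕ} (ha : g.Bv + l.length ≤ a) : g.dataW l a = 0 := by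
  unfold dataW; rw [if_neg (by omega), if_neg (by omega)]

/-- Written cells are below `Pw`. [folklore] -/
theorem dataW_lt_Pw (l : List ℕ) {a : ℕ} (ha : g.Bv ≤ a) : g.dataW l a < g.Pw := by
  unfold dataW; rw [if_neg (by omega)]
  split_ifs
  · exact Nat.mod_lt _ (Nat.two_pow_pos _)
  · exact Nat.two_pow_pos _

end Params

namespace Params

variable (g : Params) {W : ℕ} {O : List ℕ → List ℕ}

/-! ### Register conventions -/

/-- The registers after the setup: `X, n, m, n₁, n₂, N₁, N₂, L₁, Ly, Bv`. [folklore] -/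
structure Regs (m : ℕ → ℕ) : Prop where
  r0 : m 0 = g.X
  r2 : m 2 = g.n
  r3 : m 3 = g.m
  r4 : m 4 = g.n₁
  r5 : m 5 = g.n₂
  r6 : m 6 = g.N₁
  r7 : m 7 = g.N₂
  r8 : m 8 = g.L₁
  r9 : m 9 = g.Ly
  r10 : m 10 = g.Bv

/-- The environment registers: `Sv, Gv = 0, Pw`. [folklore] -/
structure ERegs (m : ℕ → ℕ) : Prop where
  r11 : m 11 = g.Sv
  r12 : m 12 = 0
  r13 : m 13 = g.Pw

variable {g}

/-- `Regs` survives changes above register `10`. [folklore] -/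
theorem Regs.of_frame {m m' : ℕ → ℕ} (h : g.Regs m) (hf : ∀ a, a ≤ 10 → m' a = m a) : g.Regs m' :=
  ⟨(hf 0 (by omega)).trans h.r0, (hf 2 (by omega)).trans h.r2, (hf 3 (by omega)).trans h.r3,
    (hf 4 (by omega)).trans h.r4, (hf 5 (by omega)).trans h.r5, (hf 6 (by omega)).trans h.r6,
    (hf 7 (by omega)).trans h.r7, (hf 8 (by omega)).trans h.r8, (hf 9 (by omega)).trans h.r9,
    (hf 10 (by omega)).trans h.r10⟩

/-- `ERegs` survives changes outside `11–13`. [folklore] -/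
theorem ERegs.of_frame {m m' : ℕ → ℕ} (h : g.ERegs m) (hf : ∀ a, 11 ≤ a → a ≤ 13 → m' a = m a) :
    g.ERegs m' :=
  ⟨(hf 11 (by omega) (by omega)).trans h.r11, (hf 12 (by omega) (by omega)).trans h.r12,
    (hf 13 (by omega) (by omega)).trans h.r13⟩

variable (g)

/-! ### The setup phase -/

/-- **Setup, part 1.** From the relocated memory, `setup1` computes the registers `Regs`, leaves
`r1 = X - 1`, `r22 = [Ly < 9·10⁶]`, and does not touch the data. [folklore] -/
theorem setup1_spec (hF : g.Fits W) :
    Achieves W O setup1 (relocated g.x)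
      (fun m => g.Regs m ∧ m 1 = g.X - 1 ∧ m 22 = (if g.Ly < 9000000 then 1 else 0) ∧
        ∀ a, 100 ≤ a → m a = relocated g.x a) 19 := by
  obtain ⟨hX, hXLx, hBv, hSv, htop, hLyV, hPwV, hcMV, hmLx, hL₁, hL₂, hLy, hN₁, hN₂, hPw1, hn,
    hn₁₂, hnW, h16, hNN, hPwW, hNL₁, hNL₂, hWW⟩ := g.facts hF
  have en₁ : g.n / 2 = g.n₁ := rfl
  have en₂ : g.n - g.n₁ = g.n₂ := rfl
  have eN₁ : 2 ^ g.n₁ = g.N₁ := rfl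
  have eN₂ : 2 ^ g.n₂ = g.N₂ := rfl
  have eL₁ : g.N₁ * (g.m + 3) = g.L₁ := rfl
  have eL₂ : g.N₂ * (g.m + 1) + 4 = g.L₂ := rfl
  have eLy : (g.L₁ + g.L₂) * 2 + 2 = g.Ly := rfl
  have hreadn : relocated g.x g.X = g.n := g.relocated_X
  have hreadm : relocated g.x (g.X + 1) = g.m := g.relocated_X_one
  have h2n₁ : 2 ^ g.n₁ < 2 ^ W := by rw [eN₁]; omega
  have h2n₂ : 2 ^ g.n₂ < 2 ^ W := by rw [eN₂]; omega
  refine CliqueRed.achieves_block_of_eq (fun m' hm' => ?_) (by simp [])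
  simp (disch := first | omega | decide) only [execOps_cons, execOps_nil, execOp, Operand.write,
    Operand.read, merge_apply_of_lt, merge_apply_of_le, update_merge_of_lt, Function.update_self,
    Function.update_of_ne, BinOp.eval_add_of_lt, BinOp.eval_sub_of_le, BinOp.eval_mul_of_lt,
    BinOp.eval_shl_of_lt, BinOp.eval_div, BinOp.eval_band, BinOp.eval_lt, Nat.and_self, Nat.one_mul,
    relocated_zero', relocated_one', hreadn, hreadm, en₁, en₂, eN₁, eN₂, eL₁, eL₂, eLy] at hm'
  subst hm'
  refine ⟨⟨?_, ?_, ?_, ?_, ?_, ?_, ?_, ?_, ?_, ?_⟩, ?_, ?_, fun a ha => ?_⟩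
  all_goals (try simp (disch := first | omega | decide) only [merge_apply_of_lt,
    merge_apply_of_le, Function.update_self, Function.update_of_ne])
  all_goals (try simp only [relocated_zero', relocated_one'])
  all_goals omega

/-- **Setup, part 2: the width value.** `r21 := max Ly 9·10⁶ = wv`, `r22 := 0`. [folklore] -/
theorem selectWidth_spec {m : ℕ → ℕ} (h9 : m 9 = g.Ly)
    (h22 : m 22 = (if g.Ly < 9000000 then 1 else 0)) :
    Achieves W O selectWidth m
      (fun m' => m' 21 = g.wv ∧ m' 22 = 0 ∧ ∀ a, a ≠ 21 → a ≠ 22 → m' a = m a) 4 := by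
  unfold selectWidth
  refine Achieves.seqs_cons (R := fun m₁ => m₁ 21 = g.wv ∧ ∀ a, a ≠ 21 → m₁ a = m a) (T₁ := 3)
    (T₂ := 1) ?_ ?_
  · refine Achieves.ifz (fun h0 => ?_) (fun h1 => ?_)
    · simp only [Operand.read, h22] at h0
      have hle : ¬ g.Ly < 9000000 := fun hc => by simp [hc] at h0
      refine CliqueRed.achieves_block_of_eq (fun m' hm' => ?_) le_rfl
      simp (disch := first | omega | decide) only [execOps_cons, execOps_nil, execOp,
        Operand.write, Operand.read, merge_apply_of_lt, update_merge_of_lt, BinOp.eval_band,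
        Nat.and_self, h9] at hm'
      subst hm'
      refine ⟨?_, fun a ha => ?_⟩
      · simp (disch := first | omega | decide) only [merge_apply_of_lt, Function.update_self]
        unfold wv; rw [max_eq_left (not_lt.1 hle)]
      · by_cases ha' : a < 100
        · rw [merge_apply_of_lt ha', Function.update_of_ne ha]
        · rw [merge_apply_of_le (by omega)]
    · simp only [Operand.read, h22] at h1
      have hlt : g.Ly < 9000000 := by by_contra hc; simp [hc] at h1
      refine CliqueRed.achieves_block_of_eq (fun m' hm' => ?_) le_rfl
      simp (disch := first | omega | decide) only [execOps_cons, execOps_nil, execOp,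
        Operand.write, Operand.read, update_merge_of_lt, BinOp.eval_band, Nat.and_self] at hm'
      subst hm'
      refine ⟨?_, fun a ha => ?_⟩
      · simp (disch := first | omega | decide) only [merge_apply_of_lt, Function.update_self]
        unfold wv; rw [max_eq_right hlt.le]
      · by_cases ha' : a < 100
        · rw [merge_apply_of_lt ha', Function.update_of_ne ha]
        · rw [merge_apply_of_le (by omega)]
  · rintro m₁ ⟨q21, qf⟩
    refine Achieves.seqs_cons (T₁ := 1) (T₂ := 0) ?_ (fun _ h => Achieves.seqs_nil h)
    refine CliqueRed.achieves_block_of_eq (fun m' hm' => ?_) le_rfl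
    simp (disch := first | omega | decide) only [execOps_cons, execOps_nil, execOp, Operand.write,
      Operand.read, update_merge_of_lt, BinOp.eval_band, Nat.and_self] at hm'
    subst hm'
    refine ⟨?_, ?_, fun a h21 h22' => ?_⟩
    · simp (disch := first | omega | decide) only [merge_apply_of_lt, Function.update_of_ne]
      exact q21
    · simp (disch := first | omega | decide) only [merge_apply_of_lt, Function.update_self]
    · by_cases ha' : a < 100
      · rw [merge_apply_of_lt ha', Function.update_of_ne h22', qf a h21]
      · rw [merge_apply_of_le (by omega), qf a h21]

/-- **Setup, part 3.** From the registers of `setup1` and `r22 = size wv`, `setup3` sets the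
environment registers `Sv, Gv = 0, Pw` (`ERegs`), keeping `Regs` and the data. [folklore] -/
theorem setup3_spec (hF : g.Fits W) {m : ℕ → ℕ} (hR : g.Regs m) (h22 : m 22 = Nat.size g.wv)
    (hD : ∀ a, 100 ≤ a → m a = relocated g.x a) :
    Achieves W O (setup3 g.kF g.cM) m
      (fun m' => g.Regs m' ∧ g.ERegs m' ∧ ∀ a, 100 ≤ a → m' a = relocated g.x a) 14 := by
  obtain ⟨hX, hXLx, hBv, hSv, htop, hLyV, hPwV, hcMV, hmLx, hL₁, hL₂, hLy, hN₁, hN₂, hPw1, hn,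
    hn₁₂, hnW, h16, hNN, hPwW, hNL₁, hNL₂, hWW⟩ := g.facts hF
  have hwsW : g.ws < W := hF.ws_lt
  have hws : Nat.size g.wv * g.kF = g.ws := rfl
  have hPw : 2 ^ g.ws = g.Pw := rfl
  obtain ⟨r0, r2, r3, r4, r5, r6, r7, r8, r9, r10⟩ := hR
  unfold setup3
  -- block 1
  refine Achieves.seqs_cons (R := fun m₁ => m₁ 13 = g.Pw ∧ m₁ 23 = g.Pw - 1 ∧
      m₁ 24 = (if g.Pw - 1 < g.cM then 1 else 0) ∧ ∀ a, a ≠ 13 → a ≠ 22 → a ≠ 23 → a ≠ 24 →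
        m₁ a = m a) (T₁ := 4) (T₂ := 10) ?_ ?_
  · refine CliqueRed.achieves_block_of_eq (fun m' hm' => ?_) le_rfl
    simp (disch := first | omega | decide) only [execOps_cons, execOps_nil, execOp, Operand.write,
      Operand.read, merge_apply_of_lt, update_merge_of_lt, Function.update_self,
      BinOp.eval_sub_of_le, BinOp.eval_mul_of_lt, BinOp.eval_shl_of_lt, BinOp.eval_lt,
      Nat.one_mul, h22, hws, hPw] at hm'
    subst hm'
    refine ⟨?_, ?_, ?_, fun a h1 h2 h3 h4 => ?_⟩
    · (try simp (disch := first | omega | decide) only [merge_apply_of_lt, Function.update_self,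
      Function.update_of_ne])
    · (try simp (disch := first | omega | decide) only [merge_apply_of_lt, Function.update_self,
      Function.update_of_ne])
    · (try simp (disch := first | omega | decide) only [merge_apply_of_lt, Function.update_self])
    · by_cases ha : a < 100
      · rw [merge_apply_of_lt ha]; simp [Function.update_of_ne, h1, h2, h3, h4]
      · rw [merge_apply_of_le (by omega)]
  rintro m₁ ⟨q13, q23, q24, qf⟩
  -- ifz 1
  refine Achieves.seqs_cons (R := fun m₂ => m₂ 23 = max (g.Pw - 1) g.cM ∧
      ∀ a, a ≠ 22 → a ≠ 23 → a ≠ 24 → m₂ a = m₁ a) (T₁ := 3) (T₂ := 7) ?_ ?_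
  · refine Achieves.ifz (fun h0 => Achieves.skip ⟨?_, fun a _ _ _ => rfl⟩) (fun h1 => ?_)
    · simp only [Operand.read, q24] at h0
      have hc : ¬ g.Pw - 1 < g.cM := fun hc => by simp [hc] at h0
      rw [q23, max_eq_left (not_lt.1 hc)]
    · simp only [Operand.read, q24] at h1
      have hlt : g.Pw - 1 < g.cM := by by_contra hc; simp [hc] at h1
      refine CliqueRed.achieves_block_of_eq (fun m' hm' => ?_) le_rfl
      simp (disch := first | omega | decide) only [execOps_cons, execOps_nil, execOp,
        Operand.write, Operand.read, update_merge_of_lt, BinOp.eval_band, Nat.and_self] at hm'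
      subst hm'
      refine ⟨?_, fun a _ h23 _ => ?_⟩
      · (try simp (disch := first | omega | decide) only [merge_apply_of_lt,
        Function.update_self]); rw [max_eq_right hlt.le]
      · by_cases ha : a < 100
        · rw [merge_apply_of_lt ha, Function.update_of_ne h23]
        · rw [merge_apply_of_le (by omega)]
  rintro m₂ ⟨p23, pf⟩
  have p9 : m₂ 9 = g.Ly := by
    rw [pf 9 (by omega) (by omega) (by omega), qf 9 (by omega) (by omega) (by omega) (by omega), r9]
  have hmaxV : max (g.Pw - 1) g.cM ≤ g.V := max_le (by omega) hcMV
  -- block 2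
  refine Achieves.seqs_cons (R := fun m₃ => m₃ 23 = max (g.Pw - 1) g.cM ∧
      m₃ 24 = (if max (g.Pw - 1) g.cM < g.Ly then 1 else 0) ∧
      ∀ a, a ≠ 22 → a ≠ 23 → a ≠ 24 → m₃ a = m₁ a) (T₁ := 1) (T₂ := 6) ?_ ?_
  · refine CliqueRed.achieves_block_of_eq (fun m' hm' => ?_) le_rfl
    simp (disch := first | omega | decide) only [execOps_cons, execOps_nil, execOp, Operand.write,
      Operand.read, merge_apply_of_lt, update_merge_of_lt, BinOp.eval_lt, p23, p9] at hm'
    subst hm'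
    refine ⟨?_, ?_, fun a h1 h2 h3 => ?_⟩
    · (try simp (disch := first | omega | decide) only [merge_apply_of_lt,
      Function.update_of_ne]); exact p23
    · (try simp (disch := first | omega | decide) only [merge_apply_of_lt, Function.update_self])
    · by_cases ha : a < 100
      · rw [merge_apply_of_lt ha]; simp [Function.update_of_ne, h3, pf a h1 h2 h3]
      · rw [merge_apply_of_le (by omega), pf a h1 h2 h3]
  rintro m₃ ⟨s23, s24, sf⟩
  -- ifz 2
  refine Achieves.seqs_cons (R := fun m₄ => m₄ 23 = g.V ∧
      ∀ a, a ≠ 22 → a ≠ 23 → a ≠ 24 → m₄ a = m₁ a) (T₁ := 3) (T₂ := 3) ?_ ?_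
  · refine Achieves.ifz (fun h0 => Achieves.skip ⟨?_, sf⟩) (fun h1 => ?_)
    · simp only [Operand.read, s24] at h0
      have hc : ¬ max (g.Pw - 1) g.cM < g.Ly := fun hc => by simp [hc] at h0
      rw [s23]; show _ = max (g.Pw - 1) (max g.cM g.Ly)
      rw [← max_assoc, max_eq_left (not_lt.1 hc)]
    · simp only [Operand.read, s24] at h1
      have hlt : max (g.Pw - 1) g.cM < g.Ly := by by_contra hc; simp [hc] at h1
      have s9 : m₃ 9 = g.Ly := by rw [sf 9 (by omega) (by omega) (by omega), ← p9, pf 9 (by omega)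
        (by omega) (by omega)]
      refine CliqueRed.achieves_block_of_eq (fun m' hm' => ?_) le_rfl
      simp (disch := first | omega | decide) only [execOps_cons, execOps_nil, execOp,
        Operand.write, Operand.read, merge_apply_of_lt, update_merge_of_lt, BinOp.eval_band,
        Nat.and_self, s9] at hm'
      subst hm'
      refine ⟨?_, fun a h22' h23 h24 => ?_⟩
      · (try simp (disch := first | omega | decide) only [merge_apply_of_lt,
        Function.update_self]); show _ = max (g.Pw - 1) (max g.cM g.Ly)
        rw [← max_assoc, max_eq_right hlt.le]
      · by_cases ha : a < 100
        · rw [merge_apply_of_lt ha, Function.update_of_ne h23, sf a h22' h23 h24]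
        · rw [merge_apply_of_le (by omega), sf a h22' h23 h24]
  rintro m₄ ⟨t23, tf⟩
  have back : ∀ a, a ≠ 13 → a ≠ 22 → a ≠ 23 → a ≠ 24 → m₄ a = m a :=
    fun a h1 h2 h3 h4 => by rw [tf a h2 h3 h4, qf a h1 h2 h3 h4]
  have t10 : m₄ 10 = g.Bv := by
    rw [back 10 (by omega) (by omega) (by omega) (by omega), r10]
  -- block 3
  refine Achieves.seqs_cons (T₁ := 3) (T₂ := 0) ?_ (fun _ h => Achieves.seqs_nil h)
  refine CliqueRed.achieves_block_of_eq (fun m' hm' => ?_) le_rfl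
  simp (disch := first | omega | decide) only [execOps_cons, execOps_nil, execOp, Operand.write,
    Operand.read, merge_apply_of_lt, update_merge_of_lt, Function.update_self,
    BinOp.eval_add_of_lt, BinOp.eval_band, Nat.and_self, t23, t10] at hm'
  subst hm'
  refine ⟨⟨?_, ?_, ?_, ?_, ?_, ?_, ?_, ?_, ?_, ?_⟩, ⟨?_, ?_, ?_⟩, fun a ha => ?_⟩
  all_goals (try simp (disch := first | omega | decide) only [merge_apply_of_lt,
    merge_apply_of_le, Function.update_self, Function.update_of_ne])
  · rw [back 0 (by omega) (by omega) (by omega) (by omega), r0]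
  · rw [back 2 (by omega) (by omega) (by omega) (by omega), r2]
  · rw [back 3 (by omega) (by omega) (by omega) (by omega), r3]
  · rw [back 4 (by omega) (by omega) (by omega) (by omega), r4]
  · rw [back 5 (by omega) (by omega) (by omega) (by omega), r5]
  · rw [back 6 (by omega) (by omega) (by omega) (by omega), r6]
  · rw [back 7 (by omega) (by omega) (by omega) (by omega), r7]
  · rw [back 8 (by omega) (by omega) (by omega) (by omega), r8]
  · rw [back 9 (by omega) (by omega) (by omega) (by omega), r9]
  · exact t10
  · omega
  · rw [tf 13 (by omega) (by omega) (by omega), q13]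
  · rw [back a (by omega) (by omega) (by omega) (by omega), hD a ha]

/-! ### Writing -/

/-- **One write at the write pointer**, pointwise. [folklore] -/
theorem write_spec' {l : List ℕ} {m : ℕ → ℕ} (hD : ∀ a, 100 ≤ a → m a = g.dataW l a) (v e : ℕ)
    (he : e = g.Bv + l.length) :
    ∀ a, 100 ≤ a → Function.update m e (v % g.Pw) a = g.dataW (l ++ [v]) a := by
  intro a ha
  subst he
  by_cases h : a = g.Bv + l.length
  · subst h; rw [Function.update_self, dataW_append_at]
  · rw [Function.update_of_ne h, hD a ha, dataW_append_of_ne _ _ _ h]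

/-- **The header written.** From the registers and the relocated memory, `header` writes
`Ly, L₁, τ²` and sets the write pointer. [folklore] -/
theorem header_spec (hF : g.Fits W) {m : ℕ → ℕ} (hR : g.Regs m) (hE : g.ERegs m)
    (hD : ∀ a, 100 ≤ a → m a = relocated g.x a) :
    Achieves W O header m (fun m' => g.Regs m' ∧ g.ERegs m' ∧ m' 30 = g.Bv + g.hdr.length ∧
      ∀ a, 100 ≤ a → m' a = g.dataW g.hdr a) 6 := by
  obtain ⟨hX, hXLx, hBv, hSv, htop, hLyV, hPwV, hcMV, hmLx, hL₁, hL₂, hLy, hN₁, hN₂, hPw1, hn,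
    hn₁₂, hnW, h16, hNN, hPwW, hNL₁, hNL₂, hWW⟩ := g.facts hF
  obtain ⟨r0, r2, r3, r4, r5, r6, r7, r8, r9, r10⟩ := hR
  obtain ⟨r11, r12, r13⟩ := hE
  have hD' : ∀ a, 100 ≤ a → m a = g.dataW [] a := by rw [dataW_nil]; exact hD
  refine CliqueRed.achieves_block_of_eq (fun m' hm' => ?_) le_rfl
  simp (disch := first | omega | decide) only [execOps_cons, execOps_nil, execOp, Operand.write,
    Operand.read, merge_apply_of_lt, update_merge_of_lt, update_merge_of_le,
    Function.update_self, Function.update_of_ne, BinOp.eval_add_of_lt, BinOp.eval_mod, r8, r9,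
    r10, r13] at hm'
  subst hm'
  have w1 := g.write_spec' hD' g.Ly g.Bv (by simp)
  have w2 := g.write_spec' w1 g.L₁ (g.Bv + 1) (by simp)
  have w3 := g.write_spec' w2 9000000 (g.Bv + 1 + 1) (by simp)
  refine ⟨⟨?_, ?_, ?_, ?_, ?_, ?_, ?_, ?_, ?_, ?_⟩, ⟨?_, ?_, ?_⟩, ?_, fun a ha => ?_⟩
  all_goals (try simp (disch := first | omega | decide) only [merge_apply_of_lt,
    merge_apply_of_le, Function.update_self, Function.update_of_ne])
  all_goals (try assumption)
  · show g.Bv + 1 + 1 + 1 = g.Bv + 3; omega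
  · rw [w3 a ha]; rfl

/-- **Writing a point with constant coordinate words.** [folklore] -/
theorem writeConst_spec (hF : g.Fits W) (c d : ℕ) {l : List ℕ} {m : ℕ → ℕ} (h13 : m 13 = g.Pw)
    (h30 : m 30 = g.Bv + l.length) (hl : l.length + 2 ≤ g.Ly + 1)
    (hD : ∀ a, 100 ≤ a → m a = g.dataW l a) :
    Achieves W O (writeConst c d) m (fun m' => m' 30 = g.Bv + (l ++ [c, d]).length ∧
      (∀ a, a < 100 → a ≠ 30 → m' a = m a) ∧ ∀ a, 100 ≤ a → m' a = g.dataW (l ++ [c, d]) a) 4 := by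
  obtain ⟨hX, hXLx, hBv, hSv, htop, hLyV, hPwV, hcMV, hmLx, hL₁, hL₂, hLy, hN₁, hN₂, hPw1, hn,
    hn₁₂, hnW, h16, hNN, hPwW, hNL₁, hNL₂, hWW⟩ := g.facts hF
  refine CliqueRed.achieves_block_of_eq (fun m' hm' => ?_) le_rfl
  simp (disch := first | omega | decide) only [execOps_cons, execOps_nil, execOp, Operand.write,
    Operand.read, merge_apply_of_lt, update_merge_of_lt, update_merge_of_le,
    Function.update_self, Function.update_of_ne, BinOp.eval_add_of_lt, BinOp.eval_mod, h13,
    h30] at hm'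
  subst hm'
  have w1 := g.write_spec' hD c (g.Bv + l.length) rfl
  have w2 := g.write_spec' w1 d (g.Bv + l.length + 1) (by simp [Nat.add_assoc])
  refine ⟨?_, fun a ha ha' => ?_, fun a ha => ?_⟩
  · simp (disch := first | omega | decide) only [merge_apply_of_lt, Function.update_self]
    simp; omega
  · rw [merge_apply_of_lt ha]; simp [Function.update_of_ne, ha']
  · rw [merge_apply_of_le ha, w2 a ha, List.append_assoc]; rfl

/-! ### Bits and Booleans -/

/-- Equality test of two bits. [folklore] -/
theorem ite_toNat_eq_toNat (a b : Bool) : (if a.toNat = b.toNat then 1 else 0 : ℕ) = (a == b).toNat := by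
  cases a <;> cases b <;> rfl

/-- Zero test of a bit is negation. [folklore] -/
theorem ite_toNat_eq_zero (a : Bool) : (if a.toNat = 0 then 1 else 0 : ℕ) = (!a).toNat := by
  cases a <;> rfl

/-- `any` over one more element of a list. [folklore] -/
theorem any_take_succ {α : Type*} (l : List α) (f : α → Bool) {t : ℕ} (ht : t < l.length) :
    (l.take (t + 1)).any f = ((l.take t).any f || f (l[t]'ht)) := by
  rw [List.take_add_one, List.getElem?_eq_getElem ht, Option.toList_some, List.any_append]
  simp

/-- The hit of one literal of the first curve: `[v < n₁] ∧ [bit v of A = polarity]`. [folklore] -/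
def hit₁ (n₁ A : ℕ) (l : Literal ℕ) : Bool := decide (l.1 < n₁) && (A.testBit l.1 == l.2)

/-- The hit of one literal of the second curve: `[n₁ ≤ v] ∧ [bit v of (B << n₁) = polarity]`.
[folklore] -/
def hit₂ (n₁ Bs : ℕ) (l : Literal ℕ) : Bool := (!decide (l.1 < n₁)) && (Bs.testBit l.1 == l.2)

/-- `sat₁` is the disjunction of the hits. [folklore] -/
theorem sat₁_eq_any (n₁ A : ℕ) (C : Clause ℕ) : sat₁ n₁ A C = C.any (hit₁ n₁ A) := rfl

/-- Bit `v ≥ n₁` of `B << n₁` is bit `v - n₁` of `B`. [folklore] -/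
theorem testBit_shiftLeft_of_le {n₁ B v : ℕ} (hv : n₁ ≤ v) : (B <<< n₁).testBit v = B.testBit (v - n₁) := by
  rw [Nat.testBit_shiftLeft]; simp [hv]

/-- `sat₂` is the disjunction of the hits (on `B << n₁`). [folklore] -/
theorem sat₂_eq_any (n₁ B : ℕ) (C : Clause ℕ) : sat₂ n₁ B C = C.any (hit₂ n₁ (B <<< n₁)) := by
  unfold sat₂ hit₂
  congr 1; funext l
  by_cases h : l.1 < n₁
  · simp [h]
  · rw [testBit_shiftLeft_of_le (not_lt.1 h)]; simp [h, not_lt.1 h]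

/-- **One step of the literal loops**: the register arithmetic of `litBody₁`/`litBody₂` computes
`acc ∨ ([P] ∧ [tb = pol])` (disjunction as `[[¬acc] ∧ [¬h] < 1]`, with the overflow-free
`eq`/`band`/`lt` only). [folklore] -/
theorem litStep_eq (acc tb pol : Bool) (P : Prop) [Decidable P] :
    (if ((if acc.toNat = 0 then 1 else 0) &&&
        (if ((if tb.toNat = pol.toNat then 1 else 0) &&& (if P then 1 else 0)) = 0 then 1 else 0)) < 1
      then 1 else 0 : ℕ) = (acc || (decide P && (tb == pol))).toNat := by
  by_cases hP : P <;> cases acc <;> cases tb <;> cases pol <;> simp [hP]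

/-- The same step with the negated test (second curve: `n₁ ≤ v`). [folklore] -/
theorem litStep_eq' (acc tb pol : Bool) (P : Prop) [Decidable P] :
    (if ((if acc.toNat = 0 then 1 else 0) &&&
        (if ((if tb.toNat = pol.toNat then 1 else 0) &&&
          (if (if P then 1 else 0 : ℕ) = 0 then 1 else 0)) = 0 then 1 else 0)) < 1
      then 1 else 0 : ℕ) = (acc || (!decide P && (tb == pol))).toNat := by
  by_cases hP : P <;> cases acc <;> cases tb <;> cases pol <;> simp [hP]

/-! ### The literal loops -/

/-- **The literal loop of the first curve.** From `r36 = 0`, `r37 = |C|`, `r38 = X + cs + 1`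
(`cs` the start of clause `q`), `r31 = A`, the loop ends with `r36 = sat(a₁, C)` (as a bit) and
`r38` past the clause, all registers outside `36–46` and the data unchanged, within `16 |C| + 1`
steps. [folklore] -/
theorem lit₁_spec (hF : g.Fits W) {q : ℕ} (hq : q < g.m) {A : ℕ} {l : List ℕ} {m : ℕ → ℕ}
    (hR : g.Regs m) (h31 : m 31 = A) (h36 : m 36 = 0) (h37 : m 37 = (g.φ[q]'hq).length)
    (h38 : m 38 = g.X + clauseStart g.φ q + 1) (hD : ∀ a, 100 ≤ a → m a = g.dataW l a) :
    Achieves W O (whilenz (r 37) litBody₁) m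
      (fun m' => m' 36 = (sat₁ g.n₁ A (g.φ[q]'hq)).toNat ∧
        m' 38 = g.X + clauseStart g.φ q + 1 + (g.φ[q]'hq).length ∧
        (∀ a, a < 36 ∨ 46 < a → a < 100 → m' a = m a) ∧ ∀ a, 100 ≤ a → m' a = m a)
      ((g.φ[q]'hq).length * 16 + 1) := by
  obtain ⟨hX, hXLx, hBv, hSv, htop, hLyV, hPwV, hcMV, hmLx, hL₁, hL₂, hLy, hN₁, hN₂, hPw1, hn,
    hn₁₂, hnW, h16, hNN, hPwW, hNL₁, hNL₂, hWW⟩ := g.facts hF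
  have hcs := g.clauseStart_le hq
  refine Achieves.whilenz (g.φ[q]'hq).length 14
    (fun t m' => m' 36 = (((g.φ[q]'hq).take t).any (hit₁ g.n₁ A)).toNat ∧
      m' 37 = (g.φ[q]'hq).length - t ∧ m' 38 = g.X + clauseStart g.φ q + 1 + t ∧
      (∀ a, a < 36 ∨ 46 < a → a < 100 → m' a = m a) ∧ ∀ a, 100 ≤ a → m' a = m a)
    (fun t ht m' ⟨i36, i37, i38, iF, iD⟩ => ⟨?_, ?_⟩) (fun m' ⟨_, i37, _⟩ => ?_)
    ⟨by simp [h36], by simp [h37], by simp [h38], fun a _ _ => rfl, fun a _ => rfl⟩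
    (fun m' ⟨i36, i37, i38, iF, iD⟩ => ⟨?_, i38, iF, iD⟩) (by omega)
  · -- the test reads nonzero
    simp only [Operand.read, i37]; omega
  · -- the body
    have i4 : m' 4 = g.n₁ := (iF 4 (by omega) (by omega)).trans hR.r4
    have i31 : m' 31 = A := (iF 31 (by omega) (by omega)).trans h31
    have hread : m' (g.X + clauseStart g.φ q + 1 + t) = litCode ((g.φ[q]'hq)[t]'ht) := by
      rw [iD _ (by omega), hD _ (by omega), dataW_of_lt _ _ (by omega),
        show g.X + clauseStart g.φ q + 1 + t = g.X + (clauseStart g.φ q + 1 + t) by omega,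
        relocated_X_add, g.x_getD_lit hq ht]
    refine CliqueRed.achieves_block_of_eq (fun m'' hm'' => ?_) le_rfl
    simp (disch := first | omega | decide) only [execOps_cons, execOps_nil, execOp, Operand.write,
      Operand.read, merge_apply_of_lt, merge_apply_of_le, update_merge_of_lt,
      Function.update_self, Function.update_of_ne, BinOp.eval_add_of_lt, BinOp.eval_sub_of_le,
      BinOp.eval_band, BinOp.eval_shr, BinOp.eval_lt, BinOp.eval_eq, Nat.and_self, i36, i37, i38,
      i4, i31, hread, CliqueRed.litCode_shiftRight_one, CliqueRed.litCode_and_one,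
      CliqueRed.shiftRight_and_one] at hm''
    subst hm''
    refine ⟨?_, ?_, ?_, fun a ha ha' => ?_, fun a ha => ?_⟩
    · simp (disch := first | omega | decide) only [merge_apply_of_lt, Function.update_self,
        Function.update_of_ne]
      rw [any_take_succ _ _ ht, litStep_eq]; rfl
    · simp (disch := first | omega | decide) only [merge_apply_of_lt, Function.update_self]
      omega
    · simp (disch := first | omega | decide) only [merge_apply_of_lt, Function.update_self,
        Function.update_of_ne]; omega
    · rw [merge_apply_of_lt ha']; simp (disch := omega) only [Function.update_of_ne]
      exact iF a ha ha'
    · rw [merge_apply_of_le ha]; exact iD a ha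
  · -- exit
    simp only [Operand.read, i37]; omega
  · rw [i36, List.take_length]; rfl

/-- **The literal loop of the second curve.** As `lit₁_spec`, with `r50 = B << n₁` and the test
`n₁ ≤ v`; the loop ends with `r36 = sat(a₂, C)`. [folklore] -/
theorem lit₂_spec (hF : g.Fits W) {q : ℕ} (hq : q < g.m) {B : ℕ} {l : List ℕ} {m : ℕ → ℕ}
    (hR : g.Regs m) (h50 : m 50 = B <<< g.n₁) (h36 : m 36 = 0) (h37 : m 37 = (g.φ[q]'hq).length)
    (h38 : m 38 = g.X + clauseStart g.φ q + 1) (hD : ∀ a, 100 ≤ a → m a = g.dataW l a) :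
    Achieves W O (whilenz (r 37) litBody₂) m
      (fun m' => m' 36 = (sat₂ g.n₁ B (g.φ[q]'hq)).toNat ∧
        m' 38 = g.X + clauseStart g.φ q + 1 + (g.φ[q]'hq).length ∧
        (∀ a, a < 36 ∨ 46 < a → a < 100 → m' a = m a) ∧ ∀ a, 100 ≤ a → m' a = m a)
      ((g.φ[q]'hq).length * 17 + 1) := by
  obtain ⟨hX, hXLx, hBv, hSv, htop, hLyV, hPwV, hcMV, hmLx, hL₁, hL₂, hLy, hN₁, hN₂, hPw1, hn,
    hn₁₂, hnW, h16, hNN, hPwW, hNL₁, hNL₂, hWW⟩ := g.facts hF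
  have hcs := g.clauseStart_le hq
  refine Achieves.whilenz (g.φ[q]'hq).length 15
    (fun t m' => m' 36 = (((g.φ[q]'hq).take t).any (hit₂ g.n₁ (B <<< g.n₁))).toNat ∧
      m' 37 = (g.φ[q]'hq).length - t ∧ m' 38 = g.X + clauseStart g.φ q + 1 + t ∧
      (∀ a, a < 36 ∨ 46 < a → a < 100 → m' a = m a) ∧ ∀ a, 100 ≤ a → m' a = m a)
    (fun t ht m' ⟨i36, i37, i38, iF, iD⟩ => ⟨?_, ?_⟩) (fun m' ⟨_, i37, _⟩ => ?_)
    ⟨by simp [h36], by simp [h37], by simp [h38], fun a _ _ => rfl, fun a _ => rfl⟩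
    (fun m' ⟨i36, i37, i38, iF, iD⟩ => ⟨?_, i38, iF, iD⟩) (by omega)
  · -- the test reads nonzero
    simp only [Operand.read, i37]; omega
  · -- the body
    have i4 : m' 4 = g.n₁ := (iF 4 (by omega) (by omega)).trans hR.r4
    have i50 : m' 50 = B <<< g.n₁ := (iF 50 (by omega) (by omega)).trans h50
    have hread : m' (g.X + clauseStart g.φ q + 1 + t) = litCode ((g.φ[q]'hq)[t]'ht) := by
      rw [iD _ (by omega), hD _ (by omega), dataW_of_lt _ _ (by omega),
        show g.X + clauseStart g.φ q + 1 + t = g.X + (clauseStart g.φ q + 1 + t) by omega,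
        relocated_X_add, g.x_getD_lit hq ht]
    refine CliqueRed.achieves_block_of_eq (fun m'' hm'' => ?_) le_rfl
    simp (disch := first | omega | decide) only [execOps_cons, execOps_nil, execOp, Operand.write,
      Operand.read, merge_apply_of_lt, merge_apply_of_le, update_merge_of_lt,
      Function.update_self, Function.update_of_ne, BinOp.eval_add_of_lt, BinOp.eval_sub_of_le,
      BinOp.eval_band, BinOp.eval_shr, BinOp.eval_lt, BinOp.eval_eq, Nat.and_self, i36, i37, i38,
      i4, i50, hread, CliqueRed.litCode_shiftRight_one, CliqueRed.litCode_and_one,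
      CliqueRed.shiftRight_and_one] at hm''
    subst hm''
    refine ⟨?_, ?_, ?_, fun a ha ha' => ?_, fun a ha => ?_⟩
    · simp (disch := first | omega | decide) only [merge_apply_of_lt, Function.update_self,
        Function.update_of_ne]
      rw [any_take_succ _ _ ht, litStep_eq']; rfl
    · simp (disch := first | omega | decide) only [merge_apply_of_lt, Function.update_self]
      omega
    · simp (disch := first | omega | decide) only [merge_apply_of_lt, Function.update_self,
        Function.update_of_ne]; omega
    · rw [merge_apply_of_lt ha']; simp (disch := omega) only [Function.update_of_ne]
      exact iF a ha ha'
    · rw [merge_apply_of_le ha]; exact iD a ha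
  · -- exit
    simp only [Operand.read, i37]; omega
  · rw [i36, List.take_length, sat₂_eq_any]

/-! ### The clause loops -/

/-- The words written before the clause gadgets of block `A` of the first curve. [folklore] -/
def blk₁ (A : ℕ) : List ℕ := g.hdr ++ g.wordsP₁ A ++ ptWords s₁ ++ ptWords r₁

/-- The words of the points. [folklore] -/
theorem ptWords_vals : ptWords s₁ = [0, 6000] ∧ ptWords r₁ = [0, 7800] ∧ ptWords t₁ = [4000, 6000] ∧
    ptWords s₂ = [0, 4800] ∧ ptWords s₂' = [0, 0] ∧ ptWords r₂ = [0, 1800] ∧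
    ptWords t₂' = [4000, 0] ∧ ptWords t₂ = [4000, 4800] ∧
    (∀ (e : ℕ) (b : Bool), ptWords (c₁ e b) = [e * 2000 + 2000, 7806 - b.toNat * 12]) ∧
    ∀ (e : ℕ) (b : Bool), ptWords (c₂ e b) = [e * 2000 + 2000, 1794 + b.toNat * 12] := by
  refine ⟨by decide, by decide, by decide, by decide, by decide, by decide, by decide, by decide,
    fun e b => ?_, fun e b => ?_⟩
  · have h1 : encodeInt (1000 * (e : ℤ) + 1000) = e * 2000 + 2000 := by
      rw [show (1000 * (e : ℤ) + 1000) = ((1000 * e + 1000 : ℕ) : ℤ) by push_cast; ring,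
        encodeInt_natCast]; ring
    have h2 : encodeInt (if b then 3897 else 3903 : ℤ) = 7806 - b.toNat * 12 := by
      cases b <;> decide
    simp only [ptWords, c₁, h1, h2]
  · have h1 : encodeInt (1000 * (e : ℤ) + 1000) = e * 2000 + 2000 := by
      rw [show (1000 * (e : ℤ) + 1000) = ((1000 * e + 1000 : ℕ) : ℤ) by push_cast; ring,
        encodeInt_natCast]; ring
    have h2 : encodeInt (if b then 903 else 897 : ℤ) = 1794 + b.toNat * 12 := by
      cases b <;> decide
    simp only [ptWords, c₂, h1, h2]

/-- The length of `blk₁`. [folklore] -/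
theorem length_blk₁ (A : ℕ) : (g.blk₁ A).length = 7 + A * (g.m + 3) * 2 := by
  obtain ⟨h1, -, -, -, h5, -⟩ := g.length_words
  simp only [blk₁, List.length_append, h1, h5, ptWords, List.length_cons, List.length_nil]; ring

/-- **The clause-loop invariant of block `A` of the first curve**, after `i` clause gadgets.
[folklore] -/
def ClauseInv₁ (A i : ℕ) (m : ℕ → ℕ) : Prop :=
  g.Regs m ∧ g.ERegs m ∧ m 31 = A ∧ m 32 = g.N₁ - A ∧ m 33 = i ∧ m 34 = g.m - i ∧
  m 35 = g.X + clauseStart g.φ i ∧ m 47 = i % 2 ∧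
  m 30 = g.Bv + (g.blk₁ A ++ g.cgWords₁ A i).length ∧
  ∀ a, 100 ≤ a → m a = g.dataW (g.blk₁ A ++ g.cgWords₁ A i) a

/-- Room for block `A`: its words end below `Ly`. [folklore] -/
theorem room₁ {A : ℕ} (hA : A < g.N₁) : A * (g.m + 3) * 2 + (g.m + 3) * 2 ≤ g.L₁ * 2 := by
  have := Nat.mul_le_mul_right ((g.m + 3) * 2) (Nat.succ_le_of_lt hA)
  unfold L₁; rw [Nat.succ_mul] at this; linarith [Nat.mul_assoc A (g.m + 3) 2,
    Nat.mul_assoc g.N₁ (g.m + 3) 2]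

/-- **One clause gadget of the first curve.** [folklore] -/
theorem clause₁_spec (hF : g.Fits W) {A i : ℕ} (hA : A < g.N₁) (hi : i < g.m) {m : ℕ → ℕ}
    (h : g.ClauseInv₁ A i m) :
    Achieves W O clauseBody₁ m (g.ClauseInv₁ A (i + 1)) (g.Lx * 16 + 16) := by
  obtain ⟨hX, hXLx, hBv, hSv, htop, hLyV, hPwV, hcMV, hmLx, hL₁, hL₂, hLy, hN₁, hN₂, hPw1, hn,
    hn₁₂, hnW, h16, hNN, hPwW, hNL₁, hNL₂, hWW⟩ := g.facts hF
  obtain ⟨hR, hE, h31, h32, h33, h34, h35, h47, h30, hD⟩ := h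
  have him : i < g.φ.length := hi
  have hcs := g.clauseStart_le him
  have hlen : ((g.φ[i]'him)).length ≤ g.Lx := by omega
  have hroom := g.room₁ hA
  obtain ⟨-, hcg, -, -, -, -⟩ := g.length_words
  have hL : (g.blk₁ A ++ g.cgWords₁ A i).length = 7 + A * (g.m + 3) * 2 + i * 2 := by
    rw [List.length_append, length_blk₁, hcg]
  unfold clauseBody₁
  -- clauseInit
  refine Achieves.mono (T := 3 + ((g.Lx * 16 + 1) + (12 + 0))) ?_ (fun _ h => h) (by omega)
  refine Achieves.seqs_cons (R := fun m₁ => m₁ 36 = 0 ∧ m₁ 37 = (g.φ[i]'him).length ∧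
      m₁ 38 = g.X + clauseStart g.φ i + 1 ∧ (∀ a, a < 100 → a ≠ 36 → a ≠ 37 → a ≠ 38 → m₁ a = m a) ∧
      ∀ a, 100 ≤ a → m₁ a = m a) (T₁ := 3) ?_ ?_
  · have hread : m (g.X + clauseStart g.φ i) = (g.φ[i]'him).length := by
      rw [hD _ (by omega), dataW_of_lt _ _ (by omega), relocated_X_add, g.x_getD_clauseStart him]
    refine CliqueRed.achieves_block_of_eq (fun m' hm' => ?_) le_rfl
    simp (disch := first | omega | decide) only [execOps_cons, execOps_nil, execOp, Operand.write,
      Operand.read, merge_apply_of_lt, merge_apply_of_le, update_merge_of_lt,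
      Function.update_of_ne, BinOp.eval_add_of_lt, BinOp.eval_band, Nat.and_self, h35,
      hread] at hm'
    subst hm'
    refine ⟨?_, ?_, ?_, fun a ha h1 h2 h3 => ?_, fun a ha => ?_⟩
    · simp (disch := first | omega | decide) only [merge_apply_of_lt, Function.update_self,
        Function.update_of_ne]
    · simp (disch := first | omega | decide) only [merge_apply_of_lt, Function.update_self,
        Function.update_of_ne]
    · simp (disch := first | omega | decide) only [merge_apply_of_lt, Function.update_self]
    · rw [merge_apply_of_lt ha]; simp [Function.update_of_ne, h1, h2, h3]
    · rw [merge_apply_of_le ha]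
  rintro m₁ ⟨q36, q37, q38, qf, qD⟩
  have hR₁ : g.Regs m₁ := hR.of_frame fun a ha => qf a (by omega) (by omega) (by omega) (by omega)
  have hD₁ : ∀ a, 100 ≤ a → m₁ a = g.dataW (g.blk₁ A ++ g.cgWords₁ A i) a :=
    fun a ha => (qD a ha).trans (hD a ha)
  -- the literal loop
  refine Achieves.seqs_cons (R := fun m₂ => m₂ 36 = (sat₁ g.n₁ A (g.φ[i]'him)).toNat ∧
      m₂ 38 = g.X + clauseStart g.φ i + 1 + (g.φ[i]'him).length ∧
      (∀ a, a < 36 ∨ 46 < a → a < 100 → m₂ a = m₁ a) ∧ ∀ a, 100 ≤ a → m₂ a = m₁ a)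
    (T₁ := g.Lx * 16 + 1) ?_ ?_
  · exact (g.lit₁_spec hF him hR₁ ((qf 31 (by omega) (by omega) (by omega) (by omega)).trans h31)
      q36 q37 q38 hD₁).mono (fun _ h => h) (Nat.add_le_add_right (Nat.mul_le_mul_right 16 hlen) 1)
  rintro m₂ ⟨s36, s38, sF, sD⟩
  have back : ∀ a, a < 36 ∨ 46 < a → a < 100 → a ≠ 36 → a ≠ 37 → a ≠ 38 → m₂ a = m a :=
    fun a h1 h2 h3 h4 h5 => (sF a h1 h2).trans (qf a h2 h3 h4 h5)
  have s30 : m₂ 30 = g.Bv + (g.blk₁ A ++ g.cgWords₁ A i).length :=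
    (back 30 (by omega) (by omega) (by omega) (by omega) (by omega)).trans h30
  have s13 : m₂ 13 = g.Pw := (back 13 (by omega) (by omega) (by omega) (by omega) (by omega)).trans hE.r13
  have s33 : m₂ 33 = i := (back 33 (by omega) (by omega) (by omega) (by omega) (by omega)).trans h33
  have s34 : m₂ 34 = g.m - i := (back 34 (by omega) (by omega) (by omega) (by omega) (by omega)).trans h34
  have s47 : m₂ 47 = i % 2 := (back 47 (by omega) (by omega) (by omega) (by omega) (by omega)).trans h47
  have hD₂ : ∀ a, 100 ≤ a → m₂ a = g.dataW (g.blk₁ A ++ g.cgWords₁ A i) a :=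
    fun a ha => (sD a ha).trans (hD₁ a ha)
  have hpar : i % 2 ≤ 1 := Nat.lt_succ_iff.1 (Nat.mod_lt i two_pos)
  have hsat : (sat₁ g.n₁ A (g.φ[i]'him)).toNat ≤ 1 := Bool.toNat_le _
  rw [hL] at s30
  -- emit
  refine Achieves.seqs_cons (T₁ := 12) (T₂ := 0) ?_ (fun _ h => Achieves.seqs_nil h)
  refine CliqueRed.achieves_block_of_eq (fun m' hm' => ?_) le_rfl
  simp (disch := first | omega | decide) only [execOps_cons, execOps_nil, execOp, Operand.write,
    Operand.read, merge_apply_of_lt, update_merge_of_lt, update_merge_of_le,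
    Function.update_self, Function.update_of_ne, BinOp.eval_add_of_lt, BinOp.eval_sub_of_le,
    BinOp.eval_mul_of_lt, BinOp.eval_mod, BinOp.eval_band, BinOp.eval_eq, Nat.and_self, s36, s38,
    s30, s13, s33, s34, s47] at hm'
  subst hm'
  have w1 := g.write_spec' hD₂ (i % 2 * 2000 + 2000) (g.Bv + (7 + A * (g.m + 3) * 2 + i * 2))
    (by rw [hL])
  have w2 := g.write_spec' w1 (7806 - (sat₁ g.n₁ A (g.φ[i]'him)).toNat * 12)
    (g.Bv + (7 + A * (g.m + 3) * 2 + i * 2) + 1) (by rw [List.length_append, hL]; rfl)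
  have hnew : g.blk₁ A ++ g.cgWords₁ A (i + 1) =
      g.blk₁ A ++ g.cgWords₁ A i ++ [i % 2 * 2000 + 2000] ++
        [7806 - (sat₁ g.n₁ A (g.φ[i]'him)).toNat * 12] := by
    rw [cgWords₁_succ, ptWords_vals.2.2.2.2.2.2.2.2.1, List.getD_eq_getElem _ _ him]
    simp
  refine ⟨hR.of_frame fun a ha => ?_, hE.of_frame fun a ha ha' => ?_, ?_, ?_, ?_, ?_, ?_, ?_, ?_,
    fun a ha => ?_⟩
  · rw [merge_apply_of_lt (by omega)]; simp (disch := omega) only [Function.update_of_ne]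
    exact back a (by omega) (by omega) (by omega) (by omega) (by omega)
  · rw [merge_apply_of_lt (by omega)]; simp (disch := omega) only [Function.update_of_ne]
    exact back a (by omega) (by omega) (by omega) (by omega) (by omega)
  · simp (disch := first | omega | decide) only [merge_apply_of_lt, Function.update_of_ne]
    exact (back 31 (by omega) (by omega) (by omega) (by omega) (by omega)).trans h31
  · simp (disch := first | omega | decide) only [merge_apply_of_lt, Function.update_of_ne]
    exact (back 32 (by omega) (by omega) (by omega) (by omega) (by omega)).trans h32
  · simp (disch := first | omega | decide) only [merge_apply_of_lt, Function.update_self,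
      Function.update_of_ne]
  · simp (disch := first | omega | decide) only [merge_apply_of_lt, Function.update_self]; omega
  · simp (disch := first | omega | decide) only [merge_apply_of_lt, Function.update_self,
      Function.update_of_ne]
    rw [clauseStart_succ g.φ him]; omega
  · simp (disch := first | omega | decide) only [merge_apply_of_lt, Function.update_self,
      Function.update_of_ne]
    rcases Nat.mod_two_eq_zero_or_one i with h2 | h2 <;> simp [h2] <;> omega
  · simp (disch := first | omega | decide) only [merge_apply_of_lt, Function.update_self,
      Function.update_of_ne]
    rw [hnew]; simp only [List.length_append, List.length_cons, List.length_nil, hL]; omega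
  · rw [merge_apply_of_le ha, w2 a ha, hnew]

/-! ### The blocks of the first curve -/

/-- **The block-loop invariant of the first curve**, after `A` blocks. [folklore] -/
def BlockInv₁ (A : ℕ) (m : ℕ → ℕ) : Prop :=
  g.Regs m ∧ g.ERegs m ∧ m 31 = A ∧ m 32 = g.N₁ - A ∧
  m 30 = g.Bv + (g.hdr ++ g.wordsP₁ A).length ∧
  ∀ a, 100 ≤ a → m a = g.dataW (g.hdr ++ g.wordsP₁ A) a

/-- The time of one block of the first curve. [folklore] -/
def TblockA : ℕ := g.m * (g.Lx * 16 + 18) + 19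

/-- **One block `s₁ ∘ AG(a₁) ∘ t₁` of the first curve.** [folklore] -/
theorem blockA_spec (hF : g.Fits W) {A : ℕ} (hA : A < g.N₁) {m : ℕ → ℕ} (h : g.BlockInv₁ A m) :
    Achieves W O blockA m (g.BlockInv₁ (A + 1)) g.TblockA := by
  obtain ⟨hX, hXLx, hBv, hSv, htop, hLyV, hPwV, hcMV, hmLx, hL₁, hL₂, hLy, hN₁, hN₂, hPw1, hn,
    hn₁₂, hnW, h16, hNN, hPwW, hNL₁, hNL₂, hWW⟩ := g.facts hF
  obtain ⟨hR, hE, h31, h32, h30, hD⟩ := h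
  obtain ⟨hw₁, hcg, -, -, hh, -⟩ := g.length_words
  have hroom := g.room₁ hA
  have hL0 : (g.hdr ++ g.wordsP₁ A).length = 3 + A * (g.m + 3) * 2 := by
    rw [List.length_append, hw₁, hh]
  obtain ⟨vs₁, vr₁, vt₁, -, -, -, -, -, -, -⟩ := ptWords_vals
  unfold blockA
  refine Achieves.mono (T := 4 + (4 + (4 + ((g.m * (g.Lx * 16 + 16 + 2) + 1) + (4 + (2 + 0))))))
    ?_ (fun _ h => h) (le_of_eq (by unfold TblockA; ring))
  -- s₁
  refine Achieves.seqs_cons (g.writeConst_spec hF 0 6000 hE.r13 h30 (by rw [hL0]; omega) hD) ?_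
  rintro m₁ ⟨p30, pf, pD⟩
  have hR₁ : g.Regs m₁ := hR.of_frame fun a ha => pf a (by omega) (by omega)
  have hE₁ : g.ERegs m₁ := hE.of_frame fun a ha ha' => pf a (by omega) (by omega)
  -- r₁
  refine Achieves.seqs_cons (g.writeConst_spec hF 0 7800 hE₁.r13 p30
    (by rw [List.length_append, hL0]; simp only [List.length_cons, List.length_nil]; omega) pD) ?_
  rintro m₂ ⟨q30, qf, qD⟩
  have hR₂ : g.Regs m₂ := hR₁.of_frame fun a ha => qf a (by omega) (by omega)
  have hE₂ : g.ERegs m₂ := hE₁.of_frame fun a ha ha' => qf a (by omega) (by omega)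
  have q31 : m₂ 31 = A := by rw [qf 31 (by omega) (by omega), pf 31 (by omega) (by omega), h31]
  have q32 : m₂ 32 = g.N₁ - A := by rw [qf 32 (by omega) (by omega), pf 32 (by omega) (by omega), h32]
  have hlist : g.hdr ++ g.wordsP₁ A ++ [0, 6000] ++ [0, 7800] = g.blk₁ A ++ g.cgWords₁ A 0 := by
    simp [blk₁, cgWords₁, vs₁, vr₁]
  -- gadgetInit
  refine Achieves.seqs_cons (R := g.ClauseInv₁ A 0) (T₁ := 4) ?_ ?_
  · have r0 := hR₂.r0
    have r3 := hR₂.r3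
    have hX0 : (g.hdr ++ g.wordsP₁ A ++ [0, 6000] ++ [0, 7800]).length =
        (g.blk₁ A ++ g.cgWords₁ A 0).length := by rw [hlist]
    refine CliqueRed.achieves_block_of_eq (fun m' hm' => ?_) le_rfl
    simp (disch := first | omega | decide) only [execOps_cons, execOps_nil, execOp, Operand.write,
      Operand.read, merge_apply_of_lt, update_merge_of_lt, Function.update_of_ne,
      BinOp.eval_add_of_lt, BinOp.eval_band, Nat.and_self, r0, r3] at hm'
    subst hm'
    refine ⟨hR₂.of_frame fun a ha => ?_, hE₂.of_frame fun a ha ha' => ?_, ?h31, ?h32, ?h33, ?h34,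
      ?h35, ?h47, ?h30, fun a ha => ?hdat⟩
    case h31 =>
      simp (disch := first | omega | decide) only [merge_apply_of_lt, Function.update_of_ne]
      exact q31
    case h32 =>
      simp (disch := first | omega | decide) only [merge_apply_of_lt, Function.update_of_ne]
      exact q32
    case h33 =>
      simp (disch := first | omega | decide) only [merge_apply_of_lt, Function.update_self,
        Function.update_of_ne]
    case h34 =>
      simp (disch := first | omega | decide) only [merge_apply_of_lt, Function.update_self,
        Function.update_of_ne]; omega
    case h35 =>
      simp (disch := first | omega | decide) only [merge_apply_of_lt, Function.update_self,
        Function.update_of_ne]; rw [clauseStart_zero]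
    case h47 =>
      simp (disch := first | omega | decide) only [merge_apply_of_lt, Function.update_self]
    case h30 =>
      simp (disch := first | omega | decide) only [merge_apply_of_lt, Function.update_of_ne]
      rw [q30, hX0]
    case hdat => rw [merge_apply_of_le ha, qD a ha, hlist]
    · rw [merge_apply_of_lt (by omega)]; simp (disch := omega) only [Function.update_of_ne]
    · rw [merge_apply_of_lt (by omega)]; simp (disch := omega) only [Function.update_of_ne]
  intro m₃ h₃
  -- the clause loop
  refine Achieves.seqs_cons (R := g.ClauseInv₁ A g.m) (T₁ := g.m * (g.Lx * 16 + 16 + 2) + 1) ?_ ?_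
  · refine Achieves.whilenz g.m (g.Lx * 16 + 16) (fun i => g.ClauseInv₁ A i)
      (fun i hi m' hI => ⟨?_, g.clause₁_spec hF hA hi hI⟩) (fun m' hI => ?_) h₃ (fun _ h => h)
      le_rfl
    · obtain ⟨-, -, -, -, -, h34, -⟩ := hI
      simp only [Operand.read, h34]; omega
    · obtain ⟨-, -, -, -, -, h34, -⟩ := hI
      simp only [Operand.read, h34]; omega
  rintro m₄ ⟨hR₄, hE₄, s31, s32, -, -, -, -, s30, sD⟩
  have hL4 : (g.blk₁ A ++ g.cgWords₁ A g.m).length = 7 + A * (g.m + 3) * 2 + g.m * 2 := by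
    rw [List.length_append, length_blk₁, hcg]
  have hlist' : g.blk₁ A ++ g.cgWords₁ A g.m ++ [4000, 6000] = g.hdr ++ g.wordsP₁ (A + 1) := by
    rw [wordsP₁_succ, flatMap_block₁, vt₁]; simp [blk₁]
  -- t₁
  refine Achieves.seqs_cons (g.writeConst_spec hF 4000 6000 hE₄.r13 s30 (by rw [hL4]; omega) sD) ?_
  rintro m₅ ⟨t30, tf, tD⟩
  have hR₅ : g.Regs m₅ := hR₄.of_frame fun a ha => tf a (by omega) (by omega)
  have hE₅ : g.ERegs m₅ := hE₄.of_frame fun a ha ha' => tf a (by omega) (by omega)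
  have t31 : m₅ 31 = A := (tf 31 (by omega) (by omega)).trans s31
  have t32 : m₅ 32 = g.N₁ - A := (tf 32 (by omega) (by omega)).trans s32
  rw [hlist'] at t30 tD
  -- next assignment
  refine Achieves.seqs_cons (T₁ := 2) (T₂ := 0) ?_ (fun _ h => Achieves.seqs_nil h)
  refine CliqueRed.achieves_block_of_eq (fun m' hm' => ?_) le_rfl
  simp (disch := first | omega | decide) only [execOps_cons, execOps_nil, execOp, Operand.write,
    Operand.read, merge_apply_of_lt, update_merge_of_lt, Function.update_of_ne,
    BinOp.eval_add_of_lt, BinOp.eval_sub_of_le, t31, t32] at hm'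
  subst hm'
  refine ⟨hR₅.of_frame fun a ha => ?_, hE₅.of_frame fun a ha ha' => ?_, ?_, ?_, ?_, fun a ha => ?_⟩
  · rw [merge_apply_of_lt (by omega)]; simp (disch := omega) only [Function.update_of_ne]
  · rw [merge_apply_of_lt (by omega)]; simp (disch := omega) only [Function.update_of_ne]
  · simp (disch := first | omega | decide) only [merge_apply_of_lt, Function.update_self,
      Function.update_of_ne]
  · simp (disch := first | omega | decide) only [merge_apply_of_lt, Function.update_self]; omega
  · simp (disch := first | omega | decide) only [merge_apply_of_lt, Function.update_of_ne]
    exact t30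
  · rw [merge_apply_of_le ha, tD a ha]

/-- The time of the first curve. [folklore] -/
def Tcurve₁ : ℕ := 2 + (g.N₁ * (g.TblockA + 2) + 1)

/-- **The first curve.** From the end of the header, `curve₁` writes all blocks. [folklore] -/
theorem curve₁_spec (hF : g.Fits W) {m : ℕ → ℕ} (hR : g.Regs m) (hE : g.ERegs m)
    (h30 : m 30 = g.Bv + g.hdr.length) (hD : ∀ a, 100 ≤ a → m a = g.dataW g.hdr a) :
    Achieves W O curve₁ m (g.BlockInv₁ g.N₁) g.Tcurve₁ := by
  have h0 : g.hdr ++ g.wordsP₁ 0 = g.hdr := by simp [wordsP₁]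
  unfold curve₁ Tcurve₁
  refine Achieves.seqs_cons (R := g.BlockInv₁ 0) (T₁ := 2) ?_ ?_
  · have r6 := hR.r6
    refine CliqueRed.achieves_block_of_eq (fun m' hm' => ?_) le_rfl
    simp (disch := first | omega | decide) only [execOps_cons, execOps_nil, execOp, Operand.write,
      Operand.read, merge_apply_of_lt, update_merge_of_lt, Function.update_of_ne, BinOp.eval_band,
      Nat.and_self, r6] at hm'
    subst hm'
    refine ⟨hR.of_frame fun a ha => ?_, hE.of_frame fun a ha ha' => ?_, ?_, ?_, ?_, fun a ha => ?_⟩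
    · rw [merge_apply_of_lt (by omega)]; simp (disch := omega) only [Function.update_of_ne]
    · rw [merge_apply_of_lt (by omega)]; simp (disch := omega) only [Function.update_of_ne]
    · simp (disch := first | omega | decide) only [merge_apply_of_lt, Function.update_self,
        Function.update_of_ne]
    · simp (disch := first | omega | decide) only [merge_apply_of_lt, Function.update_self]; omega
    · simp (disch := first | omega | decide) only [merge_apply_of_lt, Function.update_of_ne]
      rw [h0]; exact h30
    · rw [merge_apply_of_le ha, h0]; exact hD a ha
  intro m₁ h₁
  refine Achieves.seqs_cons (T₁ := g.N₁ * (g.TblockA + 2) + 1) (T₂ := 0) ?_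
    (fun _ h => Achieves.seqs_nil h)
  refine Achieves.whilenz g.N₁ g.TblockA (fun A => g.BlockInv₁ A)
    (fun A hA m' hI => ⟨?_, g.blockA_spec hF hA hI⟩) (fun m' hI => ?_) h₁ (fun _ h => h) le_rfl
  · obtain ⟨-, -, -, h32, -⟩ := hI
    simp only [Operand.read, h32]; omega
  · obtain ⟨-, -, -, h32, -⟩ := hI
    simp only [Operand.read, h32]; omega

/-! ### The second curve -/

/-- The words written before the clause gadgets of gadget `B` of the second curve. [folklore] -/
def blk₂ (B : ℕ) : List ℕ := g.pre₂ ++ g.wordsP₂ B ++ ptWords r₂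

/-- The length of `blk₂`. [folklore] -/
theorem length_blk₂ (B : ℕ) : (g.blk₂ B).length = 9 + g.L₁ * 2 + B * (g.m + 1) * 2 := by
  obtain ⟨-, -, h3, -, -, h6⟩ := g.length_words
  simp only [blk₂, List.length_append, h3, h6, ptWords, List.length_cons, List.length_nil]; ring

/-- **The clause-loop invariant of gadget `B` of the second curve**, after `i` clause gadgets.
[folklore] -/
def ClauseInv₂ (B i : ℕ) (m : ℕ → ℕ) : Prop :=
  g.Regs m ∧ g.ERegs m ∧ m 31 = B ∧ m 32 = g.N₂ - B ∧ m 33 = i ∧ m 34 = g.m - i ∧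
  m 35 = g.X + clauseStart g.φ i ∧ m 47 = i % 2 ∧ m 50 = B <<< g.n₁ ∧
  m 30 = g.Bv + (g.blk₂ B ++ g.cgWords₂ B i).length ∧
  ∀ a, 100 ≤ a → m a = g.dataW (g.blk₂ B ++ g.cgWords₂ B i) a

/-- Room for gadget `B`: its words end four words below the end. [folklore] -/
theorem room₂ {B : ℕ} (hB : B < g.N₂) : B * (g.m + 1) * 2 + (g.m + 1) * 2 + 8 ≤ g.L₂ * 2 := by
  have := Nat.mul_le_mul_right ((g.m + 1) * 2) (Nat.succ_le_of_lt hB)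
  unfold L₂; rw [Nat.succ_mul] at this; linarith [Nat.mul_assoc B (g.m + 1) 2,
    Nat.mul_assoc g.N₂ (g.m + 1) 2]

/-- **One clause gadget of the second curve.** [folklore] -/
theorem clause₂_spec (hF : g.Fits W) {B i : ℕ} (hB : B < g.N₂) (hi : i < g.m) {m : ℕ → ℕ}
    (h : g.ClauseInv₂ B i m) :
    Achieves W O clauseBody₂ m (g.ClauseInv₂ B (i + 1)) (g.Lx * 17 + 16) := by
  obtain ⟨hX, hXLx, hBv, hSv, htop, hLyV, hPwV, hcMV, hmLx, hL₁, hL₂, hLy, hN₁, hN₂, hPw1, hn,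
    hn₁₂, hnW, h16, hNN, hPwW, hNL₁, hNL₂, hWW⟩ := g.facts hF
  obtain ⟨hR, hE, h31, h32, h33, h34, h35, h47, h50, h30, hD⟩ := h
  have him : i < g.φ.length := hi
  have hcs := g.clauseStart_le him
  have hlen : ((g.φ[i]'him)).length ≤ g.Lx := by omega
  have hroom := g.room₂ hB
  obtain ⟨-, -, -, hcg, -, -⟩ := g.length_words
  have hL : (g.blk₂ B ++ g.cgWords₂ B i).length = 9 + g.L₁ * 2 + B * (g.m + 1) * 2 + i * 2 := by
    rw [List.length_append, length_blk₂, hcg]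
  unfold clauseBody₂
  -- clauseInit
  refine Achieves.mono (T := 3 + ((g.Lx * 17 + 1) + (12 + 0))) ?_ (fun _ h => h) (by omega)
  refine Achieves.seqs_cons (R := fun m₁ => m₁ 36 = 0 ∧ m₁ 37 = (g.φ[i]'him).length ∧
      m₁ 38 = g.X + clauseStart g.φ i + 1 ∧ (∀ a, a < 100 → a ≠ 36 → a ≠ 37 → a ≠ 38 → m₁ a = m a) ∧
      ∀ a, 100 ≤ a → m₁ a = m a) (T₁ := 3) ?_ ?_
  · have hread : m (g.X + clauseStart g.φ i) = (g.φ[i]'him).length := by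
      rw [hD _ (by omega), dataW_of_lt _ _ (by omega), relocated_X_add, g.x_getD_clauseStart him]
    refine CliqueRed.achieves_block_of_eq (fun m' hm' => ?_) le_rfl
    simp (disch := first | omega | decide) only [execOps_cons, execOps_nil, execOp, Operand.write,
      Operand.read, merge_apply_of_lt, merge_apply_of_le, update_merge_of_lt,
      Function.update_of_ne, BinOp.eval_add_of_lt, BinOp.eval_band, Nat.and_self, h35,
      hread] at hm'
    subst hm'
    refine ⟨?_, ?_, ?_, fun a ha h1 h2 h3 => ?_, fun a ha => ?_⟩
    · simp (disch := first | omega | decide) only [merge_apply_of_lt, Function.update_self,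
        Function.update_of_ne]
    · simp (disch := first | omega | decide) only [merge_apply_of_lt, Function.update_self,
        Function.update_of_ne]
    · simp (disch := first | omega | decide) only [merge_apply_of_lt, Function.update_self]
    · rw [merge_apply_of_lt ha]; simp [Function.update_of_ne, h1, h2, h3]
    · rw [merge_apply_of_le ha]
  rintro m₁ ⟨q36, q37, q38, qf, qD⟩
  have hR₁ : g.Regs m₁ := hR.of_frame fun a ha => qf a (by omega) (by omega) (by omega) (by omega)
  have hD₁ : ∀ a, 100 ≤ a → m₁ a = g.dataW (g.blk₂ B ++ g.cgWords₂ B i) a :=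
    fun a ha => (qD a ha).trans (hD a ha)
  -- the literal loop
  refine Achieves.seqs_cons (R := fun m₂ => m₂ 36 = (sat₂ g.n₁ B (g.φ[i]'him)).toNat ∧
      m₂ 38 = g.X + clauseStart g.φ i + 1 + (g.φ[i]'him).length ∧
      (∀ a, a < 36 ∨ 46 < a → a < 100 → m₂ a = m₁ a) ∧ ∀ a, 100 ≤ a → m₂ a = m₁ a)
    (T₁ := g.Lx * 17 + 1) ?_ ?_
  · exact (g.lit₂_spec hF him hR₁ ((qf 50 (by omega) (by omega) (by omega) (by omega)).trans h50)
      q36 q37 q38 hD₁).mono (fun _ h => h) (Nat.add_le_add_right (Nat.mul_le_mul_right 17 hlen) 1)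
  rintro m₂ ⟨s36, s38, sF, sD⟩
  have back : ∀ a, a < 36 ∨ 46 < a → a < 100 → a ≠ 36 → a ≠ 37 → a ≠ 38 → m₂ a = m a :=
    fun a h1 h2 h3 h4 h5 => (sF a h1 h2).trans (qf a h2 h3 h4 h5)
  have s30 : m₂ 30 = g.Bv + (g.blk₂ B ++ g.cgWords₂ B i).length :=
    (back 30 (by omega) (by omega) (by omega) (by omega) (by omega)).trans h30
  have s13 : m₂ 13 = g.Pw := (back 13 (by omega) (by omega) (by omega) (by omega) (by omega)).trans hE.r13
  have s33 : m₂ 33 = i := (back 33 (by omega) (by omega) (by omega) (by omega) (by omega)).trans h33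
  have s34 : m₂ 34 = g.m - i := (back 34 (by omega) (by omega) (by omega) (by omega) (by omega)).trans h34
  have s47 : m₂ 47 = i % 2 := (back 47 (by omega) (by omega) (by omega) (by omega) (by omega)).trans h47
  have hD₂ : ∀ a, 100 ≤ a → m₂ a = g.dataW (g.blk₂ B ++ g.cgWords₂ B i) a :=
    fun a ha => (sD a ha).trans (hD₁ a ha)
  have hpar : i % 2 ≤ 1 := Nat.lt_succ_iff.1 (Nat.mod_lt i two_pos)
  have hsat : (sat₂ g.n₁ B (g.φ[i]'him)).toNat ≤ 1 := Bool.toNat_le _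
  rw [hL] at s30
  -- emit
  refine Achieves.seqs_cons (T₁ := 12) (T₂ := 0) ?_ (fun _ h => Achieves.seqs_nil h)
  refine CliqueRed.achieves_block_of_eq (fun m' hm' => ?_) le_rfl
  simp (disch := first | omega | decide) only [execOps_cons, execOps_nil, execOp, Operand.write,
    Operand.read, merge_apply_of_lt, update_merge_of_lt, update_merge_of_le,
    Function.update_self, Function.update_of_ne, BinOp.eval_add_of_lt, BinOp.eval_sub_of_le,
    BinOp.eval_mul_of_lt, BinOp.eval_mod, BinOp.eval_band, BinOp.eval_eq, Nat.and_self, s36, s38,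
    s30, s13, s33, s34, s47] at hm'
  subst hm'
  have w1 := g.write_spec' hD₂ (i % 2 * 2000 + 2000)
    (g.Bv + (9 + g.L₁ * 2 + B * (g.m + 1) * 2 + i * 2)) (by rw [hL])
  have w2 := g.write_spec' w1 ((sat₂ g.n₁ B (g.φ[i]'him)).toNat * 12 + 1794)
    (g.Bv + (9 + g.L₁ * 2 + B * (g.m + 1) * 2 + i * 2) + 1) (by rw [List.length_append, hL]; rfl)
  have hnew : g.blk₂ B ++ g.cgWords₂ B (i + 1) =
      g.blk₂ B ++ g.cgWords₂ B i ++ [i % 2 * 2000 + 2000] ++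
        [(sat₂ g.n₁ B (g.φ[i]'him)).toNat * 12 + 1794] := by
    rw [cgWords₂_succ, ptWords_vals.2.2.2.2.2.2.2.2.2, List.getD_eq_getElem _ _ him]
    simp [Nat.add_comm]
  refine ⟨hR.of_frame fun a ha => ?_, hE.of_frame fun a ha ha' => ?_, ?_, ?_, ?_, ?_, ?_, ?_, ?_, ?_,
    fun a ha => ?_⟩
  · rw [merge_apply_of_lt (by omega)]; simp (disch := omega) only [Function.update_of_ne]
    exact back a (by omega) (by omega) (by omega) (by omega) (by omega)
  · rw [merge_apply_of_lt (by omega)]; simp (disch := omega) only [Function.update_of_ne]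
    exact back a (by omega) (by omega) (by omega) (by omega) (by omega)
  · simp (disch := first | omega | decide) only [merge_apply_of_lt, Function.update_of_ne]
    exact (back 31 (by omega) (by omega) (by omega) (by omega) (by omega)).trans h31
  · simp (disch := first | omega | decide) only [merge_apply_of_lt, Function.update_of_ne]
    exact (back 32 (by omega) (by omega) (by omega) (by omega) (by omega)).trans h32
  · simp (disch := first | omega | decide) only [merge_apply_of_lt, Function.update_self,
      Function.update_of_ne]
  · simp (disch := first | omega | decide) only [merge_apply_of_lt, Function.update_self]; omega
  · simp (disch := first | omega | decide) only [merge_apply_of_lt, Function.update_self,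
      Function.update_of_ne]
    rw [clauseStart_succ g.φ him]; omega
  · simp (disch := first | omega | decide) only [merge_apply_of_lt, Function.update_self,
      Function.update_of_ne]
    rcases Nat.mod_two_eq_zero_or_one i with h2 | h2 <;> simp [h2] <;> omega
  · simp (disch := first | omega | decide) only [merge_apply_of_lt, Function.update_of_ne]
    exact (back 50 (by omega) (by omega) (by omega) (by omega) (by omega)).trans h50
  · simp (disch := first | omega | decide) only [merge_apply_of_lt, Function.update_self,
      Function.update_of_ne]
    rw [hnew]; simp only [List.length_append, List.length_cons, List.length_nil, hL]; omega
  · rw [merge_apply_of_le ha, w2 a ha, hnew]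

/-- **The gadget-loop invariant of the second curve**, after `B` assignment gadgets. [folklore] -/
def BlockInv₂ (B : ℕ) (m : ℕ → ℕ) : Prop :=
  g.Regs m ∧ g.ERegs m ∧ m 31 = B ∧ m 32 = g.N₂ - B ∧
  m 30 = g.Bv + (g.pre₂ ++ g.wordsP₂ B).length ∧
  ∀ a, 100 ≤ a → m a = g.dataW (g.pre₂ ++ g.wordsP₂ B) a

/-- The time of one assignment gadget of the second curve. [folklore] -/
def TblockB : ℕ := g.m * (g.Lx * 17 + 18) + 12

/-- **One assignment gadget `AG(a₂)` of the second curve.** [folklore] -/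
theorem blockB_spec (hF : g.Fits W) {B : ℕ} (hB : B < g.N₂) {m : ℕ → ℕ} (h : g.BlockInv₂ B m) :
    Achieves W O blockB m (g.BlockInv₂ (B + 1)) g.TblockB := by
  obtain ⟨hX, hXLx, hBv, hSv, htop, hLyV, hPwV, hcMV, hmLx, hL₁, hL₂, hLy, hN₁, hN₂, hPw1, hn,
    hn₁₂, hnW, h16, hNN, hPwW, hNL₁, hNL₂, hWW⟩ := g.facts hF
  obtain ⟨hR, hE, h31, h32, h30, hD⟩ := h
  obtain ⟨-, -, hw₂, hcg, -, hp⟩ := g.length_words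
  have hroom := g.room₂ hB
  have hL0 : (g.pre₂ ++ g.wordsP₂ B).length = 7 + g.L₁ * 2 + B * (g.m + 1) * 2 := by
    rw [List.length_append, hw₂, hp]; ring
  obtain ⟨-, -, -, -, -, vr₂, -, -, -, -⟩ := ptWords_vals
  have hsh : B * 2 ^ g.n₁ < 2 ^ W := by
    have h1 : B * 2 ^ g.n₁ < g.N₂ * g.N₁ := by
      unfold N₁; exact Nat.mul_lt_mul_of_lt_of_le hB le_rfl (Nat.two_pow_pos _)
    rw [Nat.mul_comm g.N₂] at h1; omega
  unfold blockB
  refine Achieves.mono (T := 1 + (4 + (4 + ((g.m * (g.Lx * 17 + 16 + 2) + 1) + (2 + 0)))))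
    ?_ (fun _ h => h) (le_of_eq (by unfold TblockB; ring))
  -- B << n₁
  refine Achieves.seqs_cons (R := fun m₁ => m₁ 50 = B <<< g.n₁ ∧ ∀ a, a ≠ 50 → m₁ a = m a)
    (T₁ := 1) ?_ ?_
  · have r4 := hR.r4
    refine CliqueRed.achieves_block_of_eq (fun m' hm' => ?_) le_rfl
    simp (disch := first | omega | decide) only [execOps_cons, execOps_nil, execOp, Operand.write,
      Operand.read, merge_apply_of_lt, update_merge_of_lt, BinOp.eval_shl_of_lt, r4, h31] at hm'
    subst hm'
    refine ⟨?_, fun a ha => ?_⟩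
    · simp (disch := first | omega | decide) only [merge_apply_of_lt, Function.update_self]
      rw [Nat.shiftLeft_eq]
    · by_cases ha' : a < 100
      · rw [merge_apply_of_lt ha', Function.update_of_ne ha]
      · rw [merge_apply_of_le (by omega)]
  rintro m₀ ⟨o50, of⟩
  have hR₀ : g.Regs m₀ := hR.of_frame fun a ha => of a (by omega)
  have hE₀ : g.ERegs m₀ := hE.of_frame fun a ha ha' => of a (by omega)
  have hD₀ : ∀ a, 100 ≤ a → m₀ a = g.dataW (g.pre₂ ++ g.wordsP₂ B) a :=
    fun a ha => (of a (by omega)).trans (hD a ha)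
  -- r₂
  refine Achieves.seqs_cons (g.writeConst_spec hF 0 1800 hE₀.r13 ((of 30 (by omega)).trans h30)
    (by rw [hL0]; omega) hD₀) ?_
  rintro m₂ ⟨q30, qf, qD⟩
  have hR₂ : g.Regs m₂ := hR₀.of_frame fun a ha => qf a (by omega) (by omega)
  have hE₂ : g.ERegs m₂ := hE₀.of_frame fun a ha ha' => qf a (by omega) (by omega)
  have q31 : m₂ 31 = B := by rw [qf 31 (by omega) (by omega), of 31 (by omega), h31]
  have q32 : m₂ 32 = g.N₂ - B := by rw [qf 32 (by omega) (by omega), of 32 (by omega), h32]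
  have q50 : m₂ 50 = B <<< g.n₁ := by rw [qf 50 (by omega) (by omega), o50]
  have hlist : g.pre₂ ++ g.wordsP₂ B ++ [0, 1800] = g.blk₂ B ++ g.cgWords₂ B 0 := by
    simp [blk₂, cgWords₂, vr₂]
  -- gadgetInit
  refine Achieves.seqs_cons (R := g.ClauseInv₂ B 0) (T₁ := 4) ?_ ?_
  · have r0 := hR₂.r0
    have r3 := hR₂.r3
    have hX0 : (g.pre₂ ++ g.wordsP₂ B ++ [0, 1800]).length = (g.blk₂ B ++ g.cgWords₂ B 0).length := by
      rw [hlist]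
    refine CliqueRed.achieves_block_of_eq (fun m' hm' => ?_) le_rfl
    simp (disch := first | omega | decide) only [execOps_cons, execOps_nil, execOp, Operand.write,
      Operand.read, merge_apply_of_lt, update_merge_of_lt, Function.update_of_ne,
      BinOp.eval_add_of_lt, BinOp.eval_band, Nat.and_self, r0, r3] at hm'
    subst hm'
    refine ⟨hR₂.of_frame fun a ha => ?_, hE₂.of_frame fun a ha ha' => ?_, ?h31, ?h32, ?h33, ?h34,
      ?h35, ?h47, ?h50, ?h30, fun a ha => ?hdat⟩
    case h31 =>
      simp (disch := first | omega | decide) only [merge_apply_of_lt, Function.update_of_ne]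
      exact q31
    case h32 =>
      simp (disch := first | omega | decide) only [merge_apply_of_lt, Function.update_of_ne]
      exact q32
    case h33 =>
      simp (disch := first | omega | decide) only [merge_apply_of_lt, Function.update_self,
        Function.update_of_ne]
    case h34 =>
      simp (disch := first | omega | decide) only [merge_apply_of_lt, Function.update_self,
        Function.update_of_ne]; omega
    case h35 =>
      simp (disch := first | omega | decide) only [merge_apply_of_lt, Function.update_self,
        Function.update_of_ne]; rw [clauseStart_zero]
    case h47 =>
      simp (disch := first | omega | decide) only [merge_apply_of_lt, Function.update_self]
    case h50 =>
      simp (disch := first | omega | decide) only [merge_apply_of_lt, Function.update_of_ne]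
      exact q50
    case h30 =>
      simp (disch := first | omega | decide) only [merge_apply_of_lt, Function.update_of_ne]
      rw [q30, hX0]
    case hdat => rw [merge_apply_of_le ha, qD a ha, hlist]
    · rw [merge_apply_of_lt (by omega)]; simp (disch := omega) only [Function.update_of_ne]
    · rw [merge_apply_of_lt (by omega)]; simp (disch := omega) only [Function.update_of_ne]
  intro m₃ h₃
  -- the clause loop
  refine Achieves.seqs_cons (R := g.ClauseInv₂ B g.m) (T₁ := g.m * (g.Lx * 17 + 16 + 2) + 1) ?_ ?_
  · refine Achieves.whilenz g.m (g.Lx * 17 + 16) (fun i => g.ClauseInv₂ B i)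
      (fun i hi m' hI => ⟨?_, g.clause₂_spec hF hB hi hI⟩) (fun m' hI => ?_) h₃ (fun _ h => h)
      le_rfl
    · obtain ⟨-, -, -, -, -, h34, -⟩ := hI
      simp only [Operand.read, h34]; omega
    · obtain ⟨-, -, -, -, -, h34, -⟩ := hI
      simp only [Operand.read, h34]; omega
  rintro m₄ ⟨hR₄, hE₄, s31, s32, -, -, -, -, -, s30, sD⟩
  have hlist' : g.blk₂ B ++ g.cgWords₂ B g.m = g.pre₂ ++ g.wordsP₂ (B + 1) := by
    rw [wordsP₂_succ, flatMap_gadget₂]; simp [blk₂]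
  rw [hlist'] at s30 sD
  -- next assignment
  refine Achieves.seqs_cons (T₁ := 2) (T₂ := 0) ?_ (fun _ h => Achieves.seqs_nil h)
  refine CliqueRed.achieves_block_of_eq (fun m' hm' => ?_) le_rfl
  simp (disch := first | omega | decide) only [execOps_cons, execOps_nil, execOp, Operand.write,
    Operand.read, merge_apply_of_lt, update_merge_of_lt, Function.update_of_ne,
    BinOp.eval_add_of_lt, BinOp.eval_sub_of_le, s31, s32] at hm'
  subst hm'
  refine ⟨hR₄.of_frame fun a ha => ?_, hE₄.of_frame fun a ha ha' => ?_, ?_, ?_, ?_, fun a ha => ?_⟩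
  · rw [merge_apply_of_lt (by omega)]; simp (disch := omega) only [Function.update_of_ne]
  · rw [merge_apply_of_lt (by omega)]; simp (disch := omega) only [Function.update_of_ne]
  · simp (disch := first | omega | decide) only [merge_apply_of_lt, Function.update_self,
      Function.update_of_ne]
  · simp (disch := first | omega | decide) only [merge_apply_of_lt, Function.update_self]; omega
  · simp (disch := first | omega | decide) only [merge_apply_of_lt, Function.update_of_ne]
    exact s30
  · rw [merge_apply_of_le ha, sD a ha]

/-- The time of the second curve. [folklore] -/
def Tcurve₂ : ℕ := 4 + (4 + (2 + ((g.N₂ * (g.TblockB + 2) + 1) + (4 + (4 + 0)))))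

/-- **The second curve.** From the end of the first curve, `curve₂` writes `s₂, s₂*`, all
assignment gadgets, `t₂*, t₂`: the data is then final. [folklore] -/
theorem curve₂_spec (hF : g.Fits W) {m : ℕ → ℕ} (h : g.BlockInv₁ g.N₁ m) :
    Achieves W O curve₂ m (fun m' => g.Regs m' ∧ g.ERegs m' ∧ ∀ a, 100 ≤ a → m' a = g.finData a)
      g.Tcurve₂ := by
  obtain ⟨hX, hXLx, hBv, hSv, htop, hLyV, hPwV, hcMV, hmLx, hL₁, hL₂, hLy, hN₁, hN₂, hPw1, hn,
    hn₁₂, hnW, h16, hNN, hPwW, hNL₁, hNL₂, hWW⟩ := g.facts hF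
  obtain ⟨hR, hE, -, -, h30, hD⟩ := h
  obtain ⟨hw₁, -, hw₂, -, hh, hp⟩ := g.length_words
  obtain ⟨-, -, -, vs₂, vs₂', -, vt₂', vt₂, -, -⟩ := ptWords_vals
  have hL0 : (g.hdr ++ g.wordsP₁ g.N₁).length = 3 + g.L₁ * 2 := by
    rw [List.length_append, hw₁, hh]; unfold L₁; ring
  have hLN : (g.pre₂ ++ g.wordsP₂ g.N₂).length = 7 + g.L₁ * 2 + (g.L₂ - 4) * 2 := by
    rw [List.length_append, hw₂, hp]; unfold L₂; rw [Nat.add_sub_cancel]; ring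
  unfold curve₂ Tcurve₂
  -- s₂
  refine Achieves.seqs_cons (g.writeConst_spec hF 0 4800 hE.r13 h30 (by rw [hL0]; omega) hD) ?_
  rintro m₁ ⟨p30, pf, pD⟩
  have hR₁ : g.Regs m₁ := hR.of_frame fun a ha => pf a (by omega) (by omega)
  have hE₁ : g.ERegs m₁ := hE.of_frame fun a ha ha' => pf a (by omega) (by omega)
  -- s₂'
  refine Achieves.seqs_cons (g.writeConst_spec hF 0 0 hE₁.r13 p30
    (by rw [List.length_append, hL0]; simp only [List.length_cons, List.length_nil]; omega) pD) ?_
  rintro m₂ ⟨q30, qf, qD⟩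
  have hR₂ : g.Regs m₂ := hR₁.of_frame fun a ha => qf a (by omega) (by omega)
  have hE₂ : g.ERegs m₂ := hE₁.of_frame fun a ha ha' => qf a (by omega) (by omega)
  have hpre : g.hdr ++ g.wordsP₁ g.N₁ ++ [0, 4800] ++ [0, 0] = g.pre₂ ++ g.wordsP₂ 0 := by
    simp [pre₂, wordsP₂, vs₂, vs₂']
  rw [hpre] at q30 qD
  -- B := 0, countdown N₂
  refine Achieves.seqs_cons (R := g.BlockInv₂ 0) (T₁ := 2) ?_ ?_
  · have r7 := hR₂.r7
    refine CliqueRed.achieves_block_of_eq (fun m' hm' => ?_) le_rfl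
    simp (disch := first | omega | decide) only [execOps_cons, execOps_nil, execOp, Operand.write,
      Operand.read, merge_apply_of_lt, update_merge_of_lt, Function.update_of_ne, BinOp.eval_band,
      Nat.and_self, r7] at hm'
    subst hm'
    refine ⟨hR₂.of_frame fun a ha => ?_, hE₂.of_frame fun a ha ha' => ?_, ?_, ?_, ?_, fun a ha => ?_⟩
    · rw [merge_apply_of_lt (by omega)]; simp (disch := omega) only [Function.update_of_ne]
    · rw [merge_apply_of_lt (by omega)]; simp (disch := omega) only [Function.update_of_ne]
    · simp (disch := first | omega | decide) only [merge_apply_of_lt, Function.update_self,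
        Function.update_of_ne]
    · simp (disch := first | omega | decide) only [merge_apply_of_lt, Function.update_self]; omega
    · simp (disch := first | omega | decide) only [merge_apply_of_lt, Function.update_of_ne]
      exact q30
    · rw [merge_apply_of_le ha]; exact qD a ha
  intro m₃ h₃
  -- the gadget loop
  refine Achieves.seqs_cons (R := g.BlockInv₂ g.N₂) (T₁ := g.N₂ * (g.TblockB + 2) + 1) ?_ ?_
  · refine Achieves.whilenz g.N₂ g.TblockB (fun B => g.BlockInv₂ B)
      (fun B hB m' hI => ⟨?_, g.blockB_spec hF hB hI⟩) (fun m' hI => ?_) h₃ (fun _ h => h) le_rfl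
    · obtain ⟨-, -, -, h32, -⟩ := hI
      simp only [Operand.read, h32]; omega
    · obtain ⟨-, -, -, h32, -⟩ := hI
      simp only [Operand.read, h32]; omega
  rintro m₄ ⟨hR₄, hE₄, -, -, s30, sD⟩
  -- t₂'
  refine Achieves.seqs_cons (g.writeConst_spec hF 4000 0 hE₄.r13 s30 (by rw [hLN]; omega) sD) ?_
  rintro m₅ ⟨t30, tf, tD⟩
  have hR₅ : g.Regs m₅ := hR₄.of_frame fun a ha => tf a (by omega) (by omega)
  have hE₅ : g.ERegs m₅ := hE₄.of_frame fun a ha ha' => tf a (by omega) (by omega)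
  -- t₂
  refine Achieves.seqs_cons (T₂ := 0) (g.writeConst_spec hF 4000 4800 hE₅.r13 t30
    (by rw [List.length_append, hLN]; simp only [List.length_cons, List.length_nil]; omega) tD) ?_
  rintro m₆ ⟨-, uf, uD⟩
  have hfin : g.pre₂ ++ g.wordsP₂ g.N₂ ++ [4000, 0] ++ [4000, 4800] = g.Ly :: g.y := by
    rw [← final_eq, vt₂', vt₂]
  refine Achieves.seqs_nil ⟨hR₅.of_frame fun a ha => uf a (by omega) (by omega),
    hE₅.of_frame fun a ha ha' => uf a (by omega) (by omega), fun a ha => ?_⟩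
  rw [uD a ha, hfin]; rfl

/-! ### The whole build -/

/-- The time of the build. [folklore] -/
def Tpre : ℕ :=
  7 * g.Lx + 19 + 4 + (Nat.size g.wv * 4 + 1) + 14 + 6 + g.Tcurve₁ + g.Tcurve₂ + 96

/-- **The build.** On the initial memory of the input `x = encodeCNFWords φ` (word size `W` with
`g.Fits W`), `pre` ends, within `Tpre` steps, in the closed-form memory `finMem`:
environment registers `Bv, Sv, 0, Pw`, all other registers `0`, and the data `finData` (relocated
input and the emulated `DiscreteFrechetDecision` input of Bringmann's instance). [folklore] -/
theorem pre_spec (hF : g.Fits W) :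
    Achieves W O (pre g.kF g.cM) (initFun g.x) (fun m => m = g.finMem) g.Tpre := by
  obtain ⟨hX, hXLx, hBv, hSv, htop, hLyV, hPwV, hcMV, hmLx, hL₁, hL₂, hLy, hN₁, hN₂, hPw1, hn,
    hn₁₂, hnW, h16, hNN, hPwW, hNL₁, hNL₂, hWW⟩ := g.facts hF
  have hwv : g.wv < 2 ^ W := by unfold wv; exact max_lt (by omega) (by omega)
  unfold pre Tpre
  refine Achieves.mono (T := 7 * g.Lx + (19 + (4 + ((Nat.size g.wv * 4 + 1) + (14 + (6 +
    (g.Tcurve₁ + (g.Tcurve₂ + (96 + 0))))))))) ?_ (fun _ h => h) (by omega)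
  -- relocate
  refine Achieves.seqs_cons (R := fun m => m = relocated g.x) (T₁ := 7 * g.Lx)
    (fun qs => ⟨relocated g.x, 7 * g.Lx, le_rfl, ?_, rfl⟩) ?_
  · have h2 := g.two_le_Lx
    unfold Lx at h2 hXLx
    exact relocate_exec (by omega) hF.input (by unfold Lx at hBv; omega) qs
  rintro m rfl
  -- setup
  refine Achieves.seqs_cons (g.setup1_spec hF) ?_
  rintro m₁ ⟨hR₁, -, h22, hD₁⟩
  refine Achieves.seqs_cons (g.selectWidth_spec hR₁.r9 h22) ?_
  rintro m₂ ⟨s21, s22, sf⟩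
  have hR₂ : g.Regs m₂ := hR₁.of_frame fun a ha => sf a (by omega) (by omega)
  have hD₂ : ∀ a, 100 ≤ a → m₂ a = relocated g.x a := fun a ha => by
    rw [sf a (by omega) (by omega), hD₁ a ha]
  refine Achieves.seqs_cons (CliqueRed.Params.sizeLoop_spec (O := O) s21 s22 hwv) ?_
  rintro m₃ ⟨t22, -, tf⟩
  have hR₃ : g.Regs m₃ := hR₂.of_frame fun a ha => tf a (by omega) (by omega)
  have hD₃ : ∀ a, 100 ≤ a → m₃ a = relocated g.x a := fun a ha => by
    rw [tf a (by omega) (by omega), hD₂ a ha]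
  refine Achieves.seqs_cons (g.setup3_spec hF hR₃ t22 hD₃) ?_
  rintro m₄ ⟨hR₄, hE₄, hD₄⟩
  -- header, curves
  refine Achieves.seqs_cons (g.header_spec hF hR₄ hE₄ hD₄) ?_
  rintro m₅ ⟨hR₅, hE₅, h30, hD₅⟩
  refine Achieves.seqs_cons (g.curve₁_spec hF hR₅ hE₅ h30 hD₅) fun m₆ h₆ => ?_
  refine Achieves.seqs_cons (g.curve₂_spec hF h₆) ?_
  rintro m₇ ⟨hR₇, hE₇, hD₇⟩
  -- clearing
  refine Achieves.seqs_cons (T₁ := 96) (T₂ := 0) ?_ fun _ h => Achieves.seqs_nil h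
  refine Achieves.block ?_ (by rw [List.length_map, CliqueRed.length_clearedRegs])
  show execOps W m₇ (CliqueRed.clearedRegs.map fun i => ((.band, CliqueRed.r i, CliqueRed.im 0,
    CliqueRed.im 0) : OpSpec)) = g.finMem
  rw [CliqueRed.execOps_clear]
  funext a
  unfold finMem
  simp only [CliqueRed.mem_clearedRegs]
  by_cases ha : a < 100
  · rw [if_pos ha]
    by_cases h10 : a = 10; · subst h10; simp [hR₇.r10]
    by_cases h11 : a = 11; · subst h11; simp [hE₇.r11]
    by_cases h12 : a = 12; · subst h12; simp [hE₇.r12]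
    by_cases h13 : a = 13; · subst h13; simp [hE₇.r13]
    rw [if_pos ⟨ha, by omega⟩, if_neg h10, if_neg h11, if_neg h13]
  · rw [if_neg (by omega), if_neg ha, hD₇ a (by omega)]

end Params

/-- The time of the whole reduction program, given a time bound `T` for the Fréchet program.
[folklore] -/
def Params.Ttotal (g : Params) (T : ℕ) : ℕ := g.Tpre + cstep * T + 4

/-- **The word-size constant** of the reduction: with `W = kfit · (n + inputWidth x)` every
address and value of the run fits (`Params.fits` of `…DiscreteFrechetReductionRun`). [folklore] -/
def Params.kfit (kF cM : ℕ) : ℕ := 30 * kF + Nat.size cM + 40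

end FrechetRed

end Literature.Computability.FineGrained
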